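import Literature.Barriers.ABC.BakerMethodBoundsStewartYu1991LineProofs
import Literature.NumberTheory.Transcendental.Waldschmidt1980HW2
import Literature.Barriers.ABC.BakerMethodBoundsEpsShape
import Literature.Barriers.ABC.BakerMethodBoundsStewartTijdemanGenericProofs
import Literature.NumberTheory.Transcendental.PadicCW77Assembly
import Mathlib.NumberTheory.Height.NumberField
import Mathlib.Analysis.Complex.ExponentialBounds
import Literature.NumberTheory.DiophantineGeometry.PadicLogFormsKummerFree
import Mathlib.Analysis.InnerProductSpace.Projection.FiniteDimensional
import Literature.NumberTheory.Transcendental.Waldschmidt1980SizeHyp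
import Literature.NumberTheory.Transcendental.PadicLiouvilleInequality
import Literature.NumberTheory.Transcendental.StewartYuPadicTheoremA
import Literature.NumberTheory.DiophantineGeometry.StewartYuPrincipalUnitReductionSharp
import HarnessLib

/-!
# The κ-door of the Stewart–Yu 1991 line and the rung `log c ≪_ε rad(abc)^{5/2+ε}` from Theorem A₁ and WP-M♭ (re-homed cell library `abc-stewartyu`)

**Part V of V** of the VERBATIM re-homing of the cell library `Summits/ABC/StewartYu/*` (cell `abc-stewartyu`: the kernel `p`-adic Baker
bound for logarithms of rational primes and its abc consequences) into `Literature/` by the Hodge foundations lane (prover p20,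
generation 39).  Provenance convention (docstrings byte-for-byte; `[folklore]` kept and supplemented by a
`[cite: … (source FOLLOWED …; the cell's adaptation, NOT a printed statement)]` tag because the gate no longer admits `[folklore]`
alone on a public theorem), the renaming convention (trailing prime on the helpers inside `…PadicCW77.Setup` / `…CW77.Setup`) and
the source list are stated in full in the header of Part Ia, `Literature/NumberTheory/Transcendental/StewartYuPadicDescentSetup.lean`;
namespace `Summit.ABC.StewartYu` → `Literature.NumberTheory.Transcendental.StewartYu`; imports from `Literature/` and Mathlib only;
one `section PartK` per source module; no `sorry`, no new axiom, NO named fact (D-0026).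

THIS FILE (8 source modules, every declaration: `KappaDoor{Slot,Algebra,Prelim,Even,Odd,,EpsShape}`, `PadicCW77EpsShapeFiveHalves`):
the κ-DOOR of the Stewart–Yu 1991 line (`KappaDoor.epsShape_of_oddFinBound`: the one-prime bound at every odd prime with
`n^{κn} p^σ`, `σ ≤ 2`, gives `log c ≪_ε rad(abc)^{max(1,κ)+ε}` — one `p`-adic slot with the max-ord device, the odd member, the
even and the odd case; `KappaDoor.epsShapeBound_of_principal_core`: the M1⁺ composition), and the rung
**`StewartYu.epsShapeBound_five_halves : EpsShapeBound (5/2)`** — for every `ε > 0` there are `κ, c₀` with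
`log c ≤ κ · rad(abc)^{5/2+ε}` for every abc-triple with `c ≥ c₀`, from Theorem A₁ (Part II) through WP-M♭ and the general
glue (Part IV, `StewartYuPrincipalUnitReductionSharp.lean`); `StewartYu.epsShapeBoundFiveHalves_holds` (the cell's by-name
discharge) and `glueSpecFlat_holds` verbatim.  Omitted declarations: none.
[StewartYu1991] [StewartTijdeman1986] [Waldschmidt1980]

WHAT THIS IS NOT: not `EpsShapeBound 2`; exponential in `rad`, inside the Baker class — far from Stewart–Yu's `rad^{1/3+ε}`;
the EXACT-name discharges of the Barriers leaves are in `Literature/Barriers/ABC/BakerMethodBoundsPadicPrincipalCoreHolds.lean`.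
-/

noncomputable section

/-!
## Part 1 — port of `Summits/ABC/StewartYu/KappaDoorSlot.lean`

# Cell abc-stewartyu, the κ-DOOR, I: one `p`-adic slot of the Stewart–Yu 1991 line with an
# `n^{κn} · p^σ` input (planner's `OddKappaDoorSpec`, HOME/plan/KAPPA-DOOR-RECIPE.md)

`Summits/ABC/StewartYu/KappaDoorSlot.lean` — cell `abc-stewartyu` (HOME
`run/shared/lean/pub/abc-stewartyu/`, seat p3; tranche 2, milestone M1⁺ of `HOME/plan/DAG.md`;
theorems only, no definition, no named fact).

INPUT at an odd prime `p` (the body of the planner's `AbcStewartYuPlan.PrimePadicBoundAt p K L κ σ τ τ₁`,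
the shape delivered by WP-M + Theorem A + the glue `GluePrincipalToPrime.lean`):
`ord_p(∏ qᵢ^{eᵢ} − 1) ≤ K·Lⁿ·n^{κn}·p^σ·(∏ log qᵢ)·(log max(3, max|eᵢ|))^τ·(log max(3, ∏ qᵢ))^{τ₁}`
for distinct primes `qᵢ ≠ p` and `e ≠ 0` with `∏ qᵢ^{eᵢ} ≠ 1`.

This file turns it into ONE SLOT of the printed Stewart–Yu 1991 line (the tree's
`Literature.Barriers.ABC.log_le_of_padicRoute` [cite: StewartYu1991, (9)–(14)], which is the case
`κ = 1`, `σ = 2`, `τ = τ₁ = 1` in `log log`-form):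

* `finsetBound_of_finBound` — the Finset-indexed form of the input (generators a finite set `S`
  of primes, exponents `e : ℕ → ℤ` with `|e_q| ≤ B`, `B ≥ 3`);
* **`log_le_of_kappaSlot`** — for an ODD member `w` of the triple, coprime to `uv`, with the
  congruences `ord_p w ≤ ord_p(∏_{q ∣ uv} q^{e_q} − 1)` at every `p ∣ w` (the tree's (10)–(12)):
  `log w ≤ K·Lⁿ·n^{κn}·P(w)^σ·(∏_{q ∣ uv} log q)·(log B)^τ·(log G)^{τ₁+1}` by the max-ord device
  (9), where `n = ω(uv)`, `P(w)` is the largest prime factor of `w`, and `G ≥ 4` bounds `rad(w)`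
  and `∏_{q ∣ uv} q`.

Everything is [folklore] book-keeping on the printed line; nothing new is claimed.
-/

section Part1

open _root_.Finset _root_.Real
open Literature.NumberTheory.DiophantineGeometry
open Literature.Barriers.ABC

namespace Literature.NumberTheory.Transcendental.StewartYu

namespace KappaDoor

/-- The `p`-adic input at the prime `p` in the `Fin`-indexed shape of the planner's
`PrimePadicBoundAt p K L κ σ τ τ₁` (restated here as a predicate so that theorems can quantify over
it; it is definitionally the body of that `def`). [folklore]
[cite: StewartYu1991, (9)–(14) (source FOLLOWED: the printed Stewart–Yu line, here with an n^{κn} p^σ input; the cell’s bookkeeping, NOT a printed statement)] -/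
def FinBoundAt (p : ℕ) (K L κ σ : ℝ) (τ τ₁ : ℕ) : Prop :=
  ∀ (n : ℕ) (q : Fin n → ℕ) (e : Fin n → ℤ),
    (∀ i, (q i).Prime) → Function.Injective q → (∀ i, q i ≠ p) → e ≠ 0 →
    ∏ i, ((q i : ℚ)) ^ e i ≠ 1 →
    (padicValRat p (∏ i, ((q i : ℚ)) ^ e i - 1) : ℝ) ≤
      K * L ^ n * (n : ℝ) ^ (κ * n) * (p : ℝ) ^ σ * (∏ i, Real.log (q i)) *
        Real.log (max 3 ((Finset.univ.sup fun i => (e i).natAbs : ℕ) : ℝ)) ^ τ *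
        Real.log (max 3 (∏ i, ((q i : ℕ) : ℝ))) ^ τ₁

/-! ### From the `Fin`-indexed input to a finite set of prime generators -/

/-- **The Finset form of the input.** For a prime `p`, a finite set `S` of primes not containing
`p`, exponents `e_q` with `|e_q| ≤ B` (`B ≥ 3`) and `∏_{q ∈ S} q^{e_q} ≠ 1`:
`ord_p(∏ q^{e_q} − 1) ≤ K·L^{#S}·#S^{κ#S}·p^σ·(∏_{q∈S} log q)·(log B)^τ·(log max(3, ∏_{q∈S} q))^{τ₁}`.
[folklore]
[cite: StewartYu1991, (9)–(14) (source FOLLOWED: the printed Stewart–Yu line, here with an n^{κn} p^σ input; the cell’s bookkeeping, NOT a printed statement)] -/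
theorem finsetBound_of_finBound {p : ℕ} {K L κ σ : ℝ} {τ τ₁ : ℕ} (hP : FinBoundAt p K L κ σ τ τ₁)
    (hK : 0 ≤ K) (hL : 0 ≤ L) {S : Finset ℕ} (hS : ∀ q ∈ S, q.Prime) (hpS : p ∉ S)
    (e : ℕ → ℤ) {B : ℝ} (hB3 : 3 ≤ B) (heB : ∀ q ∈ S, (|e q| : ℝ) ≤ B)
    (hne1 : ∏ q ∈ S, (q : ℚ) ^ e q ≠ 1) :
    (padicValRat p (∏ q ∈ S, (q : ℚ) ^ e q - 1) : ℝ) ≤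
      K * L ^ S.card * (S.card : ℝ) ^ (κ * S.card) * (p : ℝ) ^ σ * (∏ q ∈ S, Real.log q) *
        Real.log B ^ τ * Real.log (max 3 (∏ q ∈ S, (q : ℝ))) ^ τ₁ := by
  classical
  set n := S.card with hn
  set φ : Fin n ≃ S := S.equivFin.symm with hφ
  set q : Fin n → ℕ := fun i => (φ i : ℕ) with hqdef
  set e' : Fin n → ℤ := fun i => e (q i) with he'
  have hqS : ∀ i, q i ∈ S := fun i => (φ i).2
  have hqP : ∀ i, (q i).Prime := fun i => hS _ (hqS i)
  have hinj : Function.Injective q := fun i j hij => φ.injective (Subtype.ext hij)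
  have hqp : ∀ i, q i ≠ p := fun i h => hpS (h ▸ hqS i)
  -- re-indexing of products over `S`
  have hreidx : ∀ {M : Type} [CommMonoid M] (f : ℕ → M), ∏ i, f (q i) = ∏ x ∈ S, f x := by
    intro M _ f
    rw [← Finset.prod_coe_sort S f]
    exact Fintype.prod_equiv φ (fun i => f (q i)) (fun x => f x) (fun i => rfl)
  have hprodQ : ∏ i, ((q i : ℚ)) ^ e' i = ∏ x ∈ S, (x : ℚ) ^ e x := hreidx (fun x => (x : ℚ) ^ e x)
  have hprodlog : ∏ i, Real.log (q i) = ∏ x ∈ S, Real.log x := hreidx (fun x => Real.log x)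
  have hprodR : ∏ i, ((q i : ℕ) : ℝ) = ∏ x ∈ S, (x : ℝ) := hreidx (fun x => (x : ℝ))
  have hne1' : ∏ i, ((q i : ℚ)) ^ e' i ≠ 1 := by rw [hprodQ]; exact hne1
  have he0 : e' ≠ 0 := by
    intro h0
    apply hne1'
    simp [h0]
  have key := hP n q e' hqP hinj hqp he0 hne1'
  rw [hprodQ, hprodlog, hprodR] at key
  -- `log max(3, max |e'|) ≤ log B`
  have hsup : ((max 3 ((Finset.univ.sup fun i => (e' i).natAbs : ℕ)) : ℝ)) ≤ B := by
    refine max_le hB3 ?_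
    have h1 : ((Finset.univ.sup fun i => (e' i).natAbs : ℕ) : ℝ) ≤ B := by
      rcases Nat.eq_zero_or_pos n with h0 | hpos
      · have : (Finset.univ : Finset (Fin n)) = ∅ := by
          rw [Finset.univ_eq_empty_iff]; rw [h0]; infer_instance
        rw [this, Finset.sup_empty]; simp; linarith
      · haveI : Nonempty (Fin n) := ⟨⟨0, hpos⟩⟩
        obtain ⟨i, -, hi⟩ := Finset.exists_mem_eq_sup (Finset.univ : Finset (Fin n))
          Finset.univ_nonempty (fun i => (e' i).natAbs)
        rw [hi]
        have h2 := heB (q i) (hqS i)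
        have h3 : (((e' i).natAbs : ℕ) : ℝ) = |(e (q i) : ℝ)| := by
          rw [he', Nat.cast_natAbs, Int.cast_abs]
        rw [h3]; exact h2
    exact h1
  have hlogB : Real.log ((max 3 ((Finset.univ.sup fun i => (e' i).natAbs : ℕ)) : ℝ)) ≤ Real.log B :=
    Real.log_le_log (lt_of_lt_of_le (by norm_num) (le_max_left _ _)) hsup
  have hlog0 : 0 ≤ Real.log ((max 3 ((Finset.univ.sup fun i => (e' i).natAbs : ℕ)) : ℝ)) :=
    Real.log_nonneg ((le_max_left _ _).trans' (by norm_num))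
  have hplog0 : 0 ≤ ∏ x ∈ S, Real.log (x : ℝ) :=
    Finset.prod_nonneg fun x hx => Real.log_nonneg (by exact_mod_cast (hS x hx).one_lt.le)
  have hp0 : (0 : ℝ) ≤ (p : ℝ) ^ σ := Real.rpow_nonneg (Nat.cast_nonneg _) _
  have hmax0 : 0 ≤ Real.log (max 3 (∏ x ∈ S, (x : ℝ))) ^ τ₁ :=
    pow_nonneg (Real.log_nonneg ((le_max_left _ _).trans' (by norm_num))) _
  refine key.trans ?_
  have hA0 : 0 ≤ K * L ^ n * (n : ℝ) ^ (κ * n) * (p : ℝ) ^ σ * ∏ x ∈ S, Real.log (x : ℝ) := by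
    have : 0 ≤ (n : ℝ) ^ (κ * n) := Real.rpow_nonneg (Nat.cast_nonneg _) _
    positivity
  exact mul_le_mul_of_nonneg_right
    (mul_le_mul_of_nonneg_left (pow_le_pow_left₀ hlog0 hlogB τ) hA0) hmax0

/-! ### One slot: the max-ord device at the primes of an odd member -/

/-- **One `p`-adic slot of the line with an `n^{κn}·p^σ` input.** Let `w` be ODD, coprime to `uv`,
with `ord_p w ≤ ord_p(∏_{q ∣ uv} q^{e_q} − 1)` for every `p ∣ w` (the congruences (10)–(12)),
`|e_q| ≤ B` (`B ≥ 3`), `∏ q^{e_q} ≠ 1`; let `G ≥ 4` bound `∏_{q ∣ uv} q` and `rad w`, and `σ ≥ 0`.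
Then `log w ≤ K·Lⁿ·n^{κn}·P(w)^σ·(∏_{q ∣ uv} log q)·((log B)^τ·(log G)^{τ₁}·log G)`, `n = ω(uv)`.
[folklore]
[cite: StewartYu1991, (9)–(14) (source FOLLOWED: the printed Stewart–Yu line, here with an n^{κn} p^σ input; the cell’s bookkeeping, NOT a printed statement)] -/
theorem log_le_of_kappaSlot {K L κ σ : ℝ} {τ τ₁ : ℕ} (hK : 0 ≤ K) (hL : 0 ≤ L) (hσ : 0 ≤ σ)
    (hP : ∀ p : ℕ, p.Prime → p ≠ 2 → FinBoundAt p K L κ σ τ τ₁)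
    {G : ℝ} (hG4 : 4 ≤ G) {B : ℝ} (hB3 : 3 ≤ B)
    {w u v : ℕ} (e : ℕ → ℤ) (hw : w ≠ 0) (hwodd : Odd w) (hwuv : w.Coprime (u * v))
    (hqG : ∏ q ∈ (u * v).primeFactors, (q : ℝ) ≤ G)
    (hwG : ∏ p ∈ w.primeFactors, (p : ℝ) ≤ G)
    (heB : ∀ q ∈ (u * v).primeFactors, (|e q| : ℝ) ≤ B)
    (hne1 : ∏ q ∈ (u * v).primeFactors, (q : ℚ) ^ e q ≠ 1)
    (hval : ∀ p ∈ w.primeFactors, (w.factorization p : ℝ) ≤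
      padicValRat p (∏ q ∈ (u * v).primeFactors, (q : ℚ) ^ e q - 1)) :
    Real.log w ≤ K * L ^ (u * v).primeFactors.card *
      ((u * v).primeFactors.card : ℝ) ^ (κ * (u * v).primeFactors.card) *
      (largestPrimeFactor w : ℝ) ^ σ * (∏ q ∈ (u * v).primeFactors, Real.log q) *
      (Real.log B ^ τ * Real.log G ^ τ₁ * Real.log G) := by
  classical
  set T := (u * v).primeFactors with hT
  set n := T.card with hn
  set PL := ∏ q ∈ T, Real.log (q : ℝ) with hPL
  set Pw : ℝ := (largestPrimeFactor w : ℝ) with hPw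
  set LG := Real.log G with hLG
  have hG1 : (1 : ℝ) ≤ G := by linarith
  have hLG0 : 0 ≤ LG := Real.log_nonneg hG1
  have hlogB0 : 0 ≤ Real.log B := Real.log_nonneg (by linarith)
  have hTprime : ∀ q ∈ T, q.Prime := fun q hq => Nat.prime_of_mem_primeFactors hq
  have hPL0 : 0 ≤ PL := Finset.prod_nonneg fun q hq =>
    Real.log_nonneg (by exact_mod_cast (hTprime q hq).one_lt.le)
  have hnκ : 0 ≤ (n : ℝ) ^ (κ * n) := Real.rpow_nonneg (Nat.cast_nonneg _) _
  have hPw1 : (1 : ℝ) ≤ Pw := by rw [hPw]; exact_mod_cast one_le_largestPrimeFactor w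
  set M : ℝ := K * L ^ n * (n : ℝ) ^ (κ * n) * Pw ^ σ * PL * (Real.log B ^ τ * LG ^ τ₁) with hM
  have hM0 : 0 ≤ M := by
    have : 0 ≤ Pw ^ σ := Real.rpow_nonneg (by linarith) _
    rw [hM]; positivity
  -- the factor `log max(3, ∏_{uv} q) ≤ log G`
  have hmax : Real.log (max 3 (∏ q ∈ T, (q : ℝ))) ≤ LG := by
    refine Real.log_le_log (lt_of_lt_of_le (by norm_num) (le_max_left _ _)) (max_le (by linarith) hqG)
  have hmax0 : 0 ≤ Real.log (max 3 (∏ q ∈ T, (q : ℝ))) :=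
    Real.log_nonneg ((le_max_left _ _).trans' (by norm_num))
  -- every exponent of `w` is at most `M`
  have hbound : ∀ p ∈ w.primeFactors, (w.factorization p : ℝ) ≤ M := by
    intro p hp
    have hpp : p.Prime := Nat.prime_of_mem_primeFactors hp
    have hp2 : p ≠ 2 := by
      rintro rfl
      have h2 : 2 ∣ w := Nat.dvd_of_mem_primeFactors hp
      exact (Nat.not_even_iff_odd.mpr hwodd) (even_iff_two_dvd.mpr h2)
    have hpT : p ∉ T := by
      intro hpT
      have h1 : p ∣ w := Nat.dvd_of_mem_primeFactors hp
      have h2 : p ∣ u * v := Nat.dvd_of_mem_primeFactors hpT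
      have hg : p ∣ Nat.gcd w (u * v) := Nat.dvd_gcd h1 h2
      rw [hwuv.gcd_eq_one, Nat.dvd_one] at hg
      exact hpp.one_lt.ne' hg
    have key := finsetBound_of_finBound (hP p hpp hp2) hK hL hTprime hpT e hB3 heB hne1
    have hpP : (p : ℝ) ^ σ ≤ Pw ^ σ := by
      have : (p : ℝ) ≤ Pw := by rw [hPw]; exact_mod_cast le_largestPrimeFactor_of_mem_primeFactors hp
      exact Real.rpow_le_rpow (Nat.cast_nonneg _) this hσ
    have hp0 : (0 : ℝ) ≤ (p : ℝ) ^ σ := Real.rpow_nonneg (Nat.cast_nonneg _) _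
    calc (w.factorization p : ℝ)
        ≤ padicValRat p (∏ q ∈ T, (q : ℚ) ^ e q - 1) := hval p hp
      _ ≤ K * L ^ n * (n : ℝ) ^ (κ * n) * (p : ℝ) ^ σ * PL * Real.log B ^ τ *
            Real.log (max 3 (∏ q ∈ T, (q : ℝ))) ^ τ₁ := key
      _ ≤ K * L ^ n * (n : ℝ) ^ (κ * n) * Pw ^ σ * PL * Real.log B ^ τ * LG ^ τ₁ := by
          have h1 : K * L ^ n * (n : ℝ) ^ (κ * n) * (p : ℝ) ^ σ * PL * Real.log B ^ τ ≤
              K * L ^ n * (n : ℝ) ^ (κ * n) * Pw ^ σ * PL * Real.log B ^ τ := by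
            have h0 : 0 ≤ K * L ^ n * (n : ℝ) ^ (κ * n) := by positivity
            have := mul_le_mul_of_nonneg_left hpP h0
            exact mul_le_mul_of_nonneg_right (mul_le_mul_of_nonneg_right this hPL0) (by positivity)
          have h2 : Real.log (max 3 (∏ q ∈ T, (q : ℝ))) ^ τ₁ ≤ LG ^ τ₁ := pow_le_pow_left₀ hmax0 hmax τ₁
          have h3 : 0 ≤ K * L ^ n * (n : ℝ) ^ (κ * n) * Pw ^ σ * PL * Real.log B ^ τ := by
            have : 0 ≤ Pw ^ σ := Real.rpow_nonneg (by linarith) _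
            positivity
          exact mul_le_mul h1 h2 (pow_nonneg hmax0 _) h3
      _ = M := by rw [hM]; ring
  -- (9)
  have h9 := log_le_mul_log_prod_primeFactors hw hbound
  have hradw : Real.log (∏ p ∈ w.primeFactors, (p : ℝ)) ≤ LG := by
    rw [hLG]
    apply Real.log_le_log _ hwG
    exact Finset.prod_pos fun q hq => by exact_mod_cast (Nat.prime_of_mem_primeFactors hq).pos
  calc Real.log w ≤ M * Real.log (∏ p ∈ w.primeFactors, (p : ℝ)) := h9
    _ ≤ M * LG := mul_le_mul_of_nonneg_left hradw hM0
    _ = K * L ^ n * (n : ℝ) ^ (κ * n) * Pw ^ σ * PL * (Real.log B ^ τ * LG ^ τ₁ * LG) := by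
        rw [hM]; ring

end KappaDoor

end Literature.NumberTheory.Transcendental.StewartYu

end Part1

/-!
## Part 2 — port of `Summits/ABC/StewartYu/KappaDoorAlgebra.lean`

# Cell abc-stewartyu, the κ-DOOR, II: the real-number book-keeping of two slots

`Summits/ABC/StewartYu/KappaDoorAlgebra.lean` — cell `abc-stewartyu` (HOME
`run/shared/lean/pub/abc-stewartyu/`, seat p3; HOME/plan/KAPPA-DOOR-RECIPE.md; theorems only).

Pure inequalities between real numbers, isolated from the arithmetic so that the assembly
(`KappaDoorMain.lean`) is book-keeping only:

* `rpow_eq_mul_rpow_sub_one` — `N^{κ'} = N · N^{κ'−1}` (`N > 0`); `rpow_le_mul_of_le_two` —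
  `P^σ ≤ P · P` for `P ≥ 1`, `0 ≤ σ ≤ 2`;
* **`two_slot_bound`** — two `p`-adic slots `uᵢ ≤ K L^{nᵢ} Nᵢ^{κ'} Pᵢ^σ Ωᵢ Y` with the Chebyshev
  absorptions `N₁ P₂ Ω₁ ≤ 600^{n₁+1} R₁ Λ³`, `N₂ P₁ Ω₂ ≤ 600^{n₂+1} R₂ Λ³`, `Pᵢ ≤ ρᵢ`,
  `R₁ R₂ ρ₁ ρ₂ ≤ G²`, `N₁ N₂ ≤ W²`, `n₁ + n₂ ≤ 2r` give
  `u₁ u₂ ≤ K² (600L)^{2r} 600² G² (W²)^{κ'−1} Λ⁶ Y²`;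
* **`slot_arch_bound`** — a `p`-adic slot and the archimedean slot bounding the same `u`:
  `u² ≤ 16 K (600 M₀)^{2r} 600² G² W^{κ'−1} Λ⁶ Y Y'`;
* small reshaping lemmas (`rpow_mul_natCast_eq`, `one_le_pow_self`, `prod_log_le_prod_log_max_four`,
  `slot_reshape`) used by `KappaDoorEven.lean` / `KappaDoorOdd.lean`.

Everything is [folklore].
-/

section Part2

open _root_.Finset _root_.Real

namespace Literature.NumberTheory.Transcendental.StewartYu

namespace KappaDoor

/-- `N^{κ'} = N · N^{κ'−1}` for `N > 0`. [folklore]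
[cite: StewartYu1991, (9)–(14) (source FOLLOWED; elementary algebra of the cell’s κ-door, NOT a printed statement)] -/
theorem rpow_eq_mul_rpow_sub_one {N κ' : ℝ} (hN : 0 < N) : N ^ κ' = N * N ^ (κ' - 1) := by
  conv_lhs => rw [show κ' = 1 + (κ' - 1) by ring, Real.rpow_add hN, Real.rpow_one]

/-- `P^σ ≤ P · P` for `P ≥ 1` and `0 ≤ σ ≤ 2`. [folklore]
[cite: StewartYu1991, (9)–(14) (source FOLLOWED; elementary algebra of the cell’s κ-door, NOT a printed statement)] -/
theorem rpow_le_mul_self_of_le_two {P σ : ℝ} (hP : 1 ≤ P) (hσ : σ ≤ 2) : P ^ σ ≤ P * P := by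
  calc P ^ σ ≤ P ^ (2 : ℝ) := Real.rpow_le_rpow_of_exponent_le hP hσ
    _ = P * P := by rw [show (2 : ℝ) = ((2 : ℕ) : ℝ) by norm_num, Real.rpow_natCast, sq]

/-- `(600 L)^{n} ≤ (600 L)^{m}` bookkeeping: `L^{n} · 600^{n+1} ≤ 600 · (600L)^{m}` for `n ≤ m`, `L ≥ 1`.
[folklore]
[cite: StewartYu1991, (9)–(14) (source FOLLOWED; elementary algebra of the cell’s κ-door, NOT a printed statement)] -/
theorem pow_mul_pow_succ_le {L : ℝ} (hL : 1 ≤ L) {n m : ℕ} (hnm : n ≤ m) :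
    L ^ n * 600 ^ (n + 1) ≤ 600 * (600 * L) ^ m := by
  have h1 : (1 : ℝ) ≤ 600 * L := by linarith
  calc L ^ n * 600 ^ (n + 1) = 600 * (600 * L) ^ n := by rw [pow_succ, mul_pow]; ring
    _ ≤ 600 * (600 * L) ^ m := by
        exact mul_le_mul_of_nonneg_left (pow_le_pow_right₀ h1 hnm) (by norm_num)

/-- **Two `p`-adic slots.** [folklore]
[cite: StewartYu1991, (9)–(14) (source FOLLOWED; elementary algebra of the cell’s κ-door, NOT a printed statement)] -/
theorem two_slot_bound {K L κ' σ u₁ u₂ N₁ N₂ P₁ P₂ Ω₁ Ω₂ Y R₁ R₂ ρ₁ ρ₂ Λ G W : ℝ} {n₁ n₂ r : ℕ}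
    (hK : 0 ≤ K) (hL : 1 ≤ L) (hκ' : 1 ≤ κ') (hσ : σ ≤ 2)
    (hu₁ : 0 ≤ u₁) (hu₂ : 0 ≤ u₂) (hN₁ : 1 ≤ N₁) (hN₂ : 1 ≤ N₂) (hP₁ : 1 ≤ P₁) (hP₂ : 1 ≤ P₂)
    (hΩ₁ : 0 ≤ Ω₁) (hΩ₂ : 0 ≤ Ω₂) (hY : 0 ≤ Y) (hR₁ : 0 ≤ R₁) (hR₂ : 0 ≤ R₂) (hΛ : 0 ≤ Λ)
    (h₁ : u₁ ≤ K * L ^ n₁ * N₁ ^ κ' * P₁ ^ σ * Ω₁ * Y)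
    (h₂ : u₂ ≤ K * L ^ n₂ * N₂ ^ κ' * P₂ ^ σ * Ω₂ * Y)
    (habs₁ : N₁ * P₂ * Ω₁ ≤ 600 ^ (n₁ + 1) * R₁ * Λ ^ 3)
    (habs₂ : N₂ * P₁ * Ω₂ ≤ 600 ^ (n₂ + 1) * R₂ * Λ ^ 3)
    (hρ₁ : P₁ ≤ ρ₁) (hρ₂ : P₂ ≤ ρ₂) (hG : R₁ * R₂ * (ρ₁ * ρ₂) ≤ G ^ 2) (hNW : N₁ * N₂ ≤ W ^ 2)
    (hn : n₁ + n₂ ≤ 2 * r) :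
    u₁ * u₂ ≤ K ^ 2 * (600 * L) ^ (2 * r) * 600 ^ 2 * G ^ 2 * (W ^ 2) ^ (κ' - 1) * Λ ^ 6 * Y ^ 2 := by
  have hN₁0 : 0 < N₁ := by linarith
  have hN₂0 : 0 < N₂ := by linarith
  have hP₁0 : 0 ≤ P₁ := by linarith
  have hP₂0 : 0 ≤ P₂ := by linarith
  have hκ0 : 0 ≤ κ' - 1 := by linarith
  -- split `N^{κ'}` and bound `P^σ`
  have e₁ : N₁ ^ κ' = N₁ * N₁ ^ (κ' - 1) := rpow_eq_mul_rpow_sub_one hN₁0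
  have e₂ : N₂ ^ κ' = N₂ * N₂ ^ (κ' - 1) := rpow_eq_mul_rpow_sub_one hN₂0
  have hp₁ : P₁ ^ σ ≤ P₁ * ρ₁ := (rpow_le_mul_self_of_le_two hP₁ hσ).trans
    (mul_le_mul_of_nonneg_left hρ₁ hP₁0)
  have hp₂ : P₂ ^ σ ≤ P₂ * ρ₂ := (rpow_le_mul_self_of_le_two hP₂ hσ).trans
    (mul_le_mul_of_nonneg_left hρ₂ hP₂0)
  have hNκ₁ : 0 ≤ N₁ ^ (κ' - 1) := Real.rpow_nonneg hN₁0.le _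
  have hNκ₂ : 0 ≤ N₂ ^ (κ' - 1) := Real.rpow_nonneg hN₂0.le _
  -- the two slots with `P^σ` replaced
  have h₁' : u₁ ≤ K * L ^ n₁ * (N₁ * N₁ ^ (κ' - 1)) * (P₁ * ρ₁) * Ω₁ * Y := by
    refine h₁.trans ?_
    rw [e₁]
    have h0 : 0 ≤ K * L ^ n₁ * (N₁ * N₁ ^ (κ' - 1)) := by positivity
    exact mul_le_mul_of_nonneg_right (mul_le_mul_of_nonneg_right
      (mul_le_mul_of_nonneg_left hp₁ h0) hΩ₁) hY
  have h₂' : u₂ ≤ K * L ^ n₂ * (N₂ * N₂ ^ (κ' - 1)) * (P₂ * ρ₂) * Ω₂ * Y := by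
    refine h₂.trans ?_
    rw [e₂]
    have h0 : 0 ≤ K * L ^ n₂ * (N₂ * N₂ ^ (κ' - 1)) := by positivity
    exact mul_le_mul_of_nonneg_right (mul_le_mul_of_nonneg_right
      (mul_le_mul_of_nonneg_left hp₂ h0) hΩ₂) hY
  have hρ₁0 : 0 ≤ ρ₁ := hP₁0.trans hρ₁
  have hρ₂0 : 0 ≤ ρ₂ := hP₂0.trans hρ₂
  have hB0 : 0 ≤ K * L ^ n₂ * (N₂ * N₂ ^ (κ' - 1)) * (P₂ * ρ₂) * Ω₂ * Y := by positivity
  have hprod := mul_le_mul h₁' h₂' hu₂ (hu₁.trans h₁')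
  -- regroup
  have e : K * L ^ n₁ * (N₁ * N₁ ^ (κ' - 1)) * (P₁ * ρ₁) * Ω₁ * Y *
      (K * L ^ n₂ * (N₂ * N₂ ^ (κ' - 1)) * (P₂ * ρ₂) * Ω₂ * Y) =
      K ^ 2 * (L ^ n₁ * L ^ n₂) * ((N₁ * P₂ * Ω₁) * (N₂ * P₁ * Ω₂)) * (ρ₁ * ρ₂) *
        (N₁ ^ (κ' - 1) * N₂ ^ (κ' - 1)) * Y ^ 2 := by ring
  rw [e] at hprod
  -- the absorptions
  have hA : (N₁ * P₂ * Ω₁) * (N₂ * P₁ * Ω₂) ≤ (600 ^ (n₁ + 1) * R₁ * Λ ^ 3) * (600 ^ (n₂ + 1) * R₂ * Λ ^ 3) :=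
    mul_le_mul habs₁ habs₂ (by positivity) (by positivity)
  -- the surplus
  have hS : N₁ ^ (κ' - 1) * N₂ ^ (κ' - 1) ≤ (W ^ 2) ^ (κ' - 1) := by
    rw [← Real.mul_rpow hN₁0.le hN₂0.le]
    exact Real.rpow_le_rpow (by positivity) hNW hκ0
  -- the powers of `L` and `600`
  have h600L : (1 : ℝ) ≤ 600 * L := by linarith
  have hL0 : 0 ≤ L := by linarith
  have hLpow : L ^ n₁ * L ^ n₂ * (600 ^ (n₁ + 1) * 600 ^ (n₂ + 1)) ≤ (600 * L) ^ (2 * r) * 600 ^ 2 := by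
    have e' : L ^ n₁ * L ^ n₂ * (600 ^ (n₁ + 1) * 600 ^ (n₂ + 1)) = (600 * L) ^ (n₁ + n₂) * 600 ^ 2 := by
      rw [mul_pow, pow_add, pow_add, pow_add L]; ring
    rw [e']
    exact mul_le_mul_of_nonneg_right (pow_le_pow_right₀ h600L hn) (by norm_num)
  calc u₁ * u₂ ≤ K ^ 2 * (L ^ n₁ * L ^ n₂) * ((N₁ * P₂ * Ω₁) * (N₂ * P₁ * Ω₂)) * (ρ₁ * ρ₂) *
        (N₁ ^ (κ' - 1) * N₂ ^ (κ' - 1)) * Y ^ 2 := hprod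
    _ ≤ K ^ 2 * (L ^ n₁ * L ^ n₂) * ((600 ^ (n₁ + 1) * R₁ * Λ ^ 3) * (600 ^ (n₂ + 1) * R₂ * Λ ^ 3)) *
        (ρ₁ * ρ₂) * (W ^ 2) ^ (κ' - 1) * Y ^ 2 := by
        have h0 : 0 ≤ K ^ 2 * (L ^ n₁ * L ^ n₂) := by positivity
        refine mul_le_mul_of_nonneg_right ?_ (by positivity)
        exact mul_le_mul (mul_le_mul_of_nonneg_right (mul_le_mul_of_nonneg_left hA h0) (by positivity))
          hS (by positivity) (by positivity)
    _ = K ^ 2 * (L ^ n₁ * L ^ n₂ * (600 ^ (n₁ + 1) * 600 ^ (n₂ + 1))) * (R₁ * R₂ * (ρ₁ * ρ₂)) *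
        (W ^ 2) ^ (κ' - 1) * Λ ^ 6 * Y ^ 2 := by ring
    _ ≤ K ^ 2 * ((600 * L) ^ (2 * r) * 600 ^ 2) * G ^ 2 * (W ^ 2) ^ (κ' - 1) * Λ ^ 6 * Y ^ 2 := by
        have hWκ : 0 ≤ (W ^ 2) ^ (κ' - 1) := Real.rpow_nonneg (by positivity) _
        refine mul_le_mul_of_nonneg_right (mul_le_mul_of_nonneg_right
          (mul_le_mul_of_nonneg_right ?_ hWκ) (by positivity)) (by positivity)
        exact mul_le_mul (mul_le_mul_of_nonneg_left hLpow (by positivity)) hG (by positivity) (by positivity)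
    _ = K ^ 2 * (600 * L) ^ (2 * r) * 600 ^ 2 * G ^ 2 * (W ^ 2) ^ (κ' - 1) * Λ ^ 6 * Y ^ 2 := by ring

/-- **A `p`-adic slot and the archimedean slot on the same member.** [folklore]
[cite: StewartYu1991, (9)–(14) (source FOLLOWED; elementary algebra of the cell’s κ-door, NOT a printed statement)] -/
theorem slot_arch_bound {K L C M₀ κ' σ u N N' P Ω Ω' Y Y' R R' ρ Λ G W : ℝ} {n n' r : ℕ}
    (hK : 0 ≤ K) (hL : 1 ≤ L) (hC : 1 ≤ C) (hLM : L ≤ M₀) (hCM : C ≤ M₀) (hκ' : 1 ≤ κ') (hσ : σ ≤ 2)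
    (hu : 0 ≤ u) (hN : 1 ≤ N) (hN' : 0 ≤ N') (hP : 1 ≤ P) (hΩ : 0 ≤ Ω) (hΩ' : 0 ≤ Ω') (hY : 0 ≤ Y)
    (hY' : 0 ≤ Y') (hR : 0 ≤ R) (hR' : 0 ≤ R') (hΛ : 0 ≤ Λ) (hW1 : 1 ≤ W)
    (h₁ : u ≤ K * L ^ n * N ^ κ' * P ^ σ * Ω * Y)
    (h₂ : u ≤ 16 * (C ^ n' * N' * Ω' * Y'))
    (habs : N * Ω ≤ 600 ^ (n + 1) * R * Λ ^ 3)
    (habs' : N' * P * Ω' ≤ 600 ^ (n' + 1) * R' * Λ ^ 3)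
    (hρ : P ≤ ρ) (hG : R * R' * ρ ≤ G ^ 2) (hNW : N ≤ W) (hn : n + n' ≤ 2 * r) :
    u ^ 2 ≤ 16 * K * (600 * M₀) ^ (2 * r) * 600 ^ 2 * G ^ 2 * (W ^ 2) ^ (κ' - 1) * Λ ^ 6 * (Y * Y') := by
  have hN0 : 0 < N := by linarith
  have hP0 : 0 ≤ P := by linarith
  have hκ0 : 0 ≤ κ' - 1 := by linarith
  have hM1 : 1 ≤ M₀ := hL.trans hLM
  have e₁ : N ^ κ' = N * N ^ (κ' - 1) := rpow_eq_mul_rpow_sub_one hN0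
  have hp : P ^ σ ≤ P * ρ := (rpow_le_mul_self_of_le_two hP hσ).trans (mul_le_mul_of_nonneg_left hρ hP0)
  have hNκ : 0 ≤ N ^ (κ' - 1) := Real.rpow_nonneg hN0.le _
  have h₁' : u ≤ K * L ^ n * (N * N ^ (κ' - 1)) * (P * ρ) * Ω * Y := by
    refine h₁.trans ?_
    rw [e₁]
    have h0 : 0 ≤ K * L ^ n * (N * N ^ (κ' - 1)) := by positivity
    exact mul_le_mul_of_nonneg_right (mul_le_mul_of_nonneg_right (mul_le_mul_of_nonneg_left hp h0) hΩ) hY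
  have hρ0 : 0 ≤ ρ := hP0.trans hρ
  have hprod := mul_le_mul h₁' h₂ hu (hu.trans h₁')
  have e : K * L ^ n * (N * N ^ (κ' - 1)) * (P * ρ) * Ω * Y * (16 * (C ^ n' * N' * Ω' * Y')) =
      16 * K * (L ^ n * C ^ n') * ((N * Ω) * (N' * P * Ω')) * ρ * N ^ (κ' - 1) * (Y * Y') := by ring
  rw [sq]
  have hA : (N * Ω) * (N' * P * Ω') ≤ (600 ^ (n + 1) * R * Λ ^ 3) * (600 ^ (n' + 1) * R' * Λ ^ 3) :=
    mul_le_mul habs habs' (by positivity) (by positivity)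
  have hS : N ^ (κ' - 1) ≤ (W ^ 2) ^ (κ' - 1) := by
    refine Real.rpow_le_rpow hN0.le (hNW.trans ?_) hκ0
    calc W = W * 1 := (mul_one W).symm
      _ ≤ W * W := mul_le_mul_of_nonneg_left hW1 (by linarith)
      _ = W ^ 2 := (sq W).symm
  have h600M : (1 : ℝ) ≤ 600 * M₀ := by linarith
  have hM0 : 0 ≤ M₀ := by linarith
  have hLC : L ^ n * C ^ n' * (600 ^ (n + 1) * 600 ^ (n' + 1)) ≤ (600 * M₀) ^ (2 * r) * 600 ^ 2 := by
    have h1 : L ^ n ≤ M₀ ^ n := pow_le_pow_left₀ (by linarith) hLM n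
    have h2 : C ^ n' ≤ M₀ ^ n' := pow_le_pow_left₀ (by linarith) hCM n'
    calc L ^ n * C ^ n' * (600 ^ (n + 1) * 600 ^ (n' + 1))
        ≤ M₀ ^ n * M₀ ^ n' * (600 ^ (n + 1) * 600 ^ (n' + 1)) :=
          mul_le_mul_of_nonneg_right (mul_le_mul h1 h2 (by positivity) (by positivity)) (by positivity)
      _ = (600 * M₀) ^ (n + n') * 600 ^ 2 := by rw [mul_pow, pow_add, pow_add, pow_add M₀]; ring
      _ ≤ (600 * M₀) ^ (2 * r) * 600 ^ 2 :=
          mul_le_mul_of_nonneg_right (pow_le_pow_right₀ h600M hn) (by norm_num)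
  calc u * u ≤ K * L ^ n * (N * N ^ (κ' - 1)) * (P * ρ) * Ω * Y * (16 * (C ^ n' * N' * Ω' * Y')) := hprod
    _ = 16 * K * (L ^ n * C ^ n') * ((N * Ω) * (N' * P * Ω')) * ρ * N ^ (κ' - 1) * (Y * Y') := e
    _ ≤ 16 * K * (L ^ n * C ^ n') * ((600 ^ (n + 1) * R * Λ ^ 3) * (600 ^ (n' + 1) * R' * Λ ^ 3)) * ρ *
          (W ^ 2) ^ (κ' - 1) * (Y * Y') := by
        have h0 : 0 ≤ 16 * K * (L ^ n * C ^ n') := by positivity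
        refine mul_le_mul_of_nonneg_right ?_ (by positivity)
        exact mul_le_mul (mul_le_mul_of_nonneg_right (mul_le_mul_of_nonneg_left hA h0) hρ0) hS hNκ
          (by positivity)
    _ = 16 * K * (L ^ n * C ^ n' * (600 ^ (n + 1) * 600 ^ (n' + 1))) * (R * R' * ρ) *
          (W ^ 2) ^ (κ' - 1) * Λ ^ 6 * (Y * Y') := by ring
    _ ≤ 16 * K * ((600 * M₀) ^ (2 * r) * 600 ^ 2) * G ^ 2 * (W ^ 2) ^ (κ' - 1) * Λ ^ 6 * (Y * Y') := by
        have hWκ : 0 ≤ (W ^ 2) ^ (κ' - 1) := Real.rpow_nonneg (by positivity) _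
        refine mul_le_mul_of_nonneg_right (mul_le_mul_of_nonneg_right
          (mul_le_mul_of_nonneg_right ?_ hWκ) (by positivity)) (by positivity)
        exact mul_le_mul (mul_le_mul_of_nonneg_left hLC (by positivity)) hG (by positivity) (by positivity)
    _ = 16 * K * (600 * M₀) ^ (2 * r) * 600 ^ 2 * G ^ 2 * (W ^ 2) ^ (κ' - 1) * Λ ^ 6 * (Y * Y') := by ring

/-! ### Small reshaping lemmas -/

/-- `n^{κ' n} = (nⁿ)^{κ'}` (real powers, `n ∈ ℕ`). [folklore]
[cite: StewartYu1991, (9)–(14) (source FOLLOWED; elementary algebra of the cell’s κ-door, NOT a printed statement)] -/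
theorem rpow_mul_natCast_eq (n : ℕ) (κ' : ℝ) : (n : ℝ) ^ (κ' * n) = ((n : ℝ) ^ n) ^ κ' := by
  rw [mul_comm, Real.rpow_mul (Nat.cast_nonneg n), Real.rpow_natCast]

/-- `1 ≤ nⁿ` (with `0⁰ = 1`). [folklore]
[cite: StewartYu1991, (9)–(14) (source FOLLOWED; elementary algebra of the cell’s κ-door, NOT a printed statement)] -/
theorem one_le_pow_self (n : ℕ) : (1 : ℝ) ≤ (n : ℝ) ^ n := by
  rcases Nat.eq_zero_or_pos n with rfl | hn
  · simp
  · exact one_le_pow₀ (by exact_mod_cast hn)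

/-- `∏_{q ∈ S} log q ≤ ∏_{q ∈ S} log max(4, q)` for a set of primes. [folklore]
[cite: StewartYu1991, (9)–(14) (source FOLLOWED; elementary algebra of the cell’s κ-door, NOT a printed statement)] -/
theorem prod_log_le_prod_log_max_four {S : Finset ℕ} (hS : ∀ q ∈ S, q.Prime) :
    ∏ q ∈ S, Real.log (q : ℝ) ≤ ∏ q ∈ S, Real.log ((max 4 q : ℕ) : ℝ) := by
  refine Finset.prod_le_prod (fun q hq => Real.log_nonneg (by exact_mod_cast (hS q hq).one_lt.le))
    fun q hq => ?_
  exact Real.log_le_log (by exact_mod_cast (hS q hq).pos) (by exact_mod_cast le_max_right 4 q)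

/-- `0 ≤ ∏_{q ∈ S} log q` for a set of primes. [folklore]
[cite: StewartYu1991, (9)–(14) (source FOLLOWED; elementary algebra of the cell’s κ-door, NOT a printed statement)] -/
theorem prod_log_nonneg {S : Finset ℕ} (hS : ∀ q ∈ S, q.Prime) : 0 ≤ ∏ q ∈ S, Real.log (q : ℝ) :=
  Finset.prod_nonneg fun q hq => Real.log_nonneg (by exact_mod_cast (hS q hq).one_lt.le)

/-- Reshaping a slot: `n^{κ'n} ↦ (nⁿ)^{κ'}`, `∏ log q ↦ Ω₄ ≥ ∏ log q`, `Y ↦ Y' ≥ Y`, with a front factor `m ≥ 1`.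
[folklore]
[cite: StewartYu1991, (9)–(14) (source FOLLOWED; elementary algebra of the cell’s κ-door, NOT a printed statement)] -/
theorem slot_reshape {K L κ' Pσ Ω Ω₄ Y Y' x m : ℝ} {n : ℕ} (hK : 0 ≤ K) (hL : 0 ≤ L) (hPσ : 0 ≤ Pσ)
    (hΩ : 0 ≤ Ω) (hΩ₄ : Ω ≤ Ω₄) (hY : 0 ≤ Y) (hYY' : Y ≤ Y') (hm : 1 ≤ m)
    (h : x ≤ m * (K * L ^ n * (n : ℝ) ^ (κ' * n) * Pσ * Ω * Y)) :
    x ≤ (m * K) * L ^ n * ((n : ℝ) ^ n) ^ κ' * Pσ * Ω₄ * Y' := by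
  rw [rpow_mul_natCast_eq] at h
  have hN : 0 ≤ ((n : ℝ) ^ n) ^ κ' := Real.rpow_nonneg (pow_nonneg (Nat.cast_nonneg _) _) _
  refine h.trans ?_
  have h0 : 0 ≤ m * K * L ^ n * ((n : ℝ) ^ n) ^ κ' * Pσ := by
    have : 0 ≤ m := by linarith
    positivity
  calc m * (K * L ^ n * ((n : ℝ) ^ n) ^ κ' * Pσ * Ω * Y)
      = (m * K * L ^ n * ((n : ℝ) ^ n) ^ κ' * Pσ) * (Ω * Y) := by ring
    _ ≤ (m * K * L ^ n * ((n : ℝ) ^ n) ^ κ' * Pσ) * (Ω₄ * Y') :=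
        mul_le_mul_of_nonneg_left (mul_le_mul hΩ₄ hYY' hY (hΩ.trans hΩ₄)) h0
    _ = (m * K) * L ^ n * ((n : ℝ) ^ n) ^ κ' * Pσ * Ω₄ * Y' := by ring

end KappaDoor

end Literature.NumberTheory.Transcendental.StewartYu

end Part2

/-!
## Part 3 — port of `Summits/ABC/StewartYu/KappaDoorPrelim.lean`

# Cell abc-stewartyu, the κ-DOOR, IIc: the slots of an abc triple and the shared book-keeping

`Summits/ABC/StewartYu/KappaDoorPrelim.lean` — cell `abc-stewartyu` (HOME
`run/shared/lean/pub/abc-stewartyu/`, seat p3; HOME/plan/KAPPA-DOOR-RECIPE.md; theorems only).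

For an abc triple `a + b = c` (`a ≤ b`, `c ≥ 3`) and the `p`-adic input `FinBoundAt p K L κ' σ τ τ₁`
at the odd primes: the three `p`-adic slots `slot_c`, `slot_b`, `slot_a` (each available when its
member is ODD; `KappaDoorSlot.log_le_of_kappaSlot` with the congruences (10)–(12) of the printed
line [cite: StewartYu1991, (10)–(12)]), the archimedean slot `slot_arch` for `a² < b` (the tree's
`log_le_of_archRoute` with Waldschmidt 1980 PROVED, `waldschmidt1980_hW₂`), the Chebyshev absorptions
`absorb_top` / `absorb_none`, and the final real book-keeping `final_shape`. Everything is [folklore].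
-/

section Part3

open _root_.Finset _root_.Real
open Literature.NumberTheory.DiophantineGeometry
open Literature.NumberTheory.DiophantineGeometry.Pasten
open Literature.NumberTheory.Transcendental.Waldschmidt1980 (w80Cw w80Cw_nonneg w80Cw_le waldschmidt1980_hW₂)
open Literature.Barriers.ABC

namespace Literature.NumberTheory.Transcendental.StewartYu

namespace KappaDoor

/-! ### Radical book-keeping -/

/-- A sub-product of the primes of `abc` is at most `rad(abc)`. [folklore]
[cite: StewartYu1991, §3 (source FOLLOWED; preliminaries of the cell’s κ-door, NOT a printed statement)] -/
theorem prod_le_rad_of_subset {a b c : ℕ} {U : Finset ℕ} (hU : U ⊆ (a * b * c).primeFactors) :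
    ∏ q ∈ U, (q : ℝ) ≤ (rad a b c : ℝ) := by
  have hradS : rad a b c = ∏ q ∈ (a * b * c).primeFactors, q := by
    rw [rad_def, Nat.radical_eq_prod_primeFactors]
  have hradpos : 0 < rad a b c := by rw [rad_def]; exact Nat.radical_pos _
  have h1 : ∏ q ∈ U, q ∣ ∏ q ∈ (a * b * c).primeFactors, q := Finset.prod_dvd_prod_of_subset _ _ _ hU
  have h2 : ∏ q ∈ U, q ≤ rad a b c := by rw [hradS]; exact Nat.le_of_dvd (hradS ▸ hradpos) h1
  have h3 := (Nat.cast_le (α := ℝ)).mpr h2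
  rwa [Nat.cast_prod] at h3

/-- `rad(abc) ≥ 4` for an abc triple with `c ≥ 3` (`b ≥ 2` and `c` carry distinct primes). [folklore]
[cite: StewartYu1991, §3 (source FOLLOWED; preliminaries of the cell’s κ-door, NOT a printed statement)] -/
theorem four_le_rad {a b c : ℕ} (h : IsABCTriple a b c) (hab : a ≤ b) (hc3 : 3 ≤ c) :
    (4 : ℝ) ≤ (rad a b c : ℝ) := by
  obtain ⟨ha, hb, habc, hcop⟩ := id h
  have hc0 : c ≠ 0 := by omega
  have ha0 : a ≠ 0 := ha.ne'
  have hb0 : b ≠ 0 := hb.ne'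
  have hb2 : 2 ≤ b := by
    by_contra hlt
    have hb1 : b = 1 := by omega
    have ha1 : a = 1 := by omega
    omega
  have hbc : b.Coprime c := coprime_right_of_isABCTriple h
  obtain ⟨qb, hqb⟩ := Nat.nonempty_primeFactors.mpr hb2
  obtain ⟨qc, hqc⟩ := Nat.nonempty_primeFactors.mpr (show 2 ≤ c by omega)
  have hne : qb ≠ qc := fun heq =>
    Finset.disjoint_left.mp hbc.disjoint_primeFactors hqb (heq ▸ hqc)
  have hS : (a * b * c).primeFactors = a.primeFactors ∪ b.primeFactors ∪ c.primeFactors := by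
    rw [Nat.primeFactors_mul (mul_ne_zero ha0 hb0) hc0, Nat.primeFactors_mul ha0 hb0]
  have hsub : ({qb, qc} : Finset ℕ) ⊆ (a * b * c).primeFactors := by
    intro q hq
    rw [hS]
    rcases Finset.mem_insert.mp hq with rfl | hq
    · exact Finset.mem_union_left _ (Finset.mem_union_right _ hqb)
    · rw [Finset.mem_singleton] at hq; rw [hq]; exact Finset.mem_union_right _ hqc
  have h1 := prod_le_rad_of_subset hsub
  rw [Finset.prod_pair hne] at h1
  have hqb2 : (2 : ℝ) ≤ qb := by exact_mod_cast (Nat.prime_of_mem_primeFactors hqb).two_le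
  have hqc2 : (2 : ℝ) ≤ qc := by exact_mod_cast (Nat.prime_of_mem_primeFactors hqc).two_le
  nlinarith

/-! ### The slots of an abc triple -/

section Slots

variable {K L κ' σ : ℝ} {τ τ₁ : ℕ} {a b c : ℕ}

/-- **The slot at `c`** (`c` odd; generators the primes of `ab`; congruence (10) with `(a/b)²`). [folklore]
[cite: StewartYu1991, §3 (source FOLLOWED; preliminaries of the cell’s κ-door, NOT a printed statement)] -/
theorem slot_c (hK : 0 ≤ K) (hL : 1 ≤ L) (hσ0 : 0 ≤ σ)
    (hP : ∀ p : ℕ, p.Prime → p ≠ 2 → FinBoundAt p K L κ' σ τ τ₁)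
    (h : IsABCTriple a b c) (hab : a ≤ b) (hc3 : 3 ≤ c) (hodd : Odd c) :
    Real.log c ≤ (1 * K) * L ^ (a * b).primeFactors.card *
      ((((a * b).primeFactors.card : ℝ)) ^ (a * b).primeFactors.card) ^ κ' *
      (largestPrimeFactor c : ℝ) ^ σ * (∏ q ∈ (a * b).primeFactors, Real.log ((max 4 q : ℕ) : ℝ)) *
      (Real.log (6 * Real.log c) ^ τ * Real.log (rad a b c : ℝ) ^ τ₁ * Real.log (rad a b c : ℝ)) := by
  obtain ⟨ha, hb, habc, hcop⟩ := id h
  have hc0 : c ≠ 0 := by omega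
  have ha0 : a ≠ 0 := ha.ne'
  have hb0 : b ≠ 0 := hb.ne'
  have hneq : a ≠ b := by
    intro heq; rw [heq] at hcop
    have : b = 1 := by simpa using hcop
    omega
  have hac : a.Coprime c := coprime_left_of_isABCTriple h
  have hbc : b.Coprime c := coprime_right_of_isABCTriple h
  have hc3r : (3 : ℝ) ≤ c := by exact_mod_cast hc3
  have hlogc1 : 1 ≤ Real.log c := by
    rw [← Real.log_exp 1]; apply Real.log_le_log (Real.exp_pos 1); have := Real.exp_one_lt_d9; linarith
  have hl1 : 0 ≤ Real.log (6 * Real.log c) := Real.log_nonneg (by linarith)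
  have hl2 : 0 ≤ Real.log (rad a b c : ℝ) := Real.log_nonneg (by have := four_le_rad h hab hc3; linarith)
  have hsub : (a * b).primeFactors ⊆ (a * b * c).primeFactors := by
    rw [Nat.primeFactors_mul (mul_ne_zero ha0 hb0) hc0]; exact Finset.subset_union_left
  have hsubc : c.primeFactors ⊆ (a * b * c).primeFactors := by
    rw [Nat.primeFactors_mul (mul_ne_zero ha0 hb0) hc0]; exact Finset.subset_union_right
  have hprime : ∀ q ∈ (a * b).primeFactors, q.Prime := fun q hq => Nat.prime_of_mem_primeFactors hq
  have heab : ∀ q ∈ (a * b).primeFactors, |(((2 * expDiff a b q : ℤ)) : ℝ)| ≤ 6 * Real.log c := by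
    intro q hq
    have hq' := abs_expDiff_le ha0 hb0 hcop (show a ≤ c by omega) (show b ≤ c by omega) q
      (Nat.prime_of_mem_primeFactors hq)
    push_cast; rw [abs_mul, Nat.abs_ofNat]; linarith
  have key := log_le_of_kappaSlot hK (by linarith) hσ0 hP (four_le_rad h hab hc3) (by linarith)
    (fun q => 2 * expDiff a b q) hc0 hodd (Nat.Coprime.mul_right hac.symm hbc.symm)
    (prod_le_rad_of_subset hsub) (prod_le_rad_of_subset hsubc) heab
    (prod_zpow_two_mul_expDiff_ne_one ha0 hb0 hcop hneq) (fun p hp => le_padicValRat_route_c h hneq hp)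
  exact slot_reshape hK (by linarith) (Real.rpow_nonneg (by positivity) _) (prod_log_nonneg hprime)
    (prod_log_le_prod_log_max_four hprime) (by positivity) le_rfl le_rfl (by rw [one_mul]; exact key)

/-- **The slot at `b`** (`b` odd; generators the primes of `ca`; congruence (11)). [folklore]
[cite: StewartYu1991, §3 (source FOLLOWED; preliminaries of the cell’s κ-door, NOT a printed statement)] -/
theorem slot_b (hK : 0 ≤ K) (hL : 1 ≤ L) (hσ0 : 0 ≤ σ)
    (hP : ∀ p : ℕ, p.Prime → p ≠ 2 → FinBoundAt p K L κ' σ τ τ₁)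
    (h : IsABCTriple a b c) (hab : a ≤ b) (hc3 : 3 ≤ c) (hodd : Odd b) :
    Real.log b ≤ (1 * K) * L ^ (c * a).primeFactors.card *
      ((((c * a).primeFactors.card : ℝ)) ^ (c * a).primeFactors.card) ^ κ' *
      (largestPrimeFactor b : ℝ) ^ σ * (∏ q ∈ (c * a).primeFactors, Real.log ((max 4 q : ℕ) : ℝ)) *
      (Real.log (6 * Real.log c) ^ τ * Real.log (rad a b c : ℝ) ^ τ₁ * Real.log (rad a b c : ℝ)) := by
  obtain ⟨ha, hb, habc, hcop⟩ := id h
  have hc0 : c ≠ 0 := by omega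
  have ha0 : a ≠ 0 := ha.ne'
  have hb0 : b ≠ 0 := hb.ne'
  have hac : a.Coprime c := coprime_left_of_isABCTriple h
  have hbc : b.Coprime c := coprime_right_of_isABCTriple h
  have hc3r : (3 : ℝ) ≤ c := by exact_mod_cast hc3
  have hlogc1 : 1 ≤ Real.log c := by
    rw [← Real.log_exp 1]; apply Real.log_le_log (Real.exp_pos 1); have := Real.exp_one_lt_d9; linarith
  have hl1 : 0 ≤ Real.log (6 * Real.log c) := Real.log_nonneg (by linarith)
  have hl2 : 0 ≤ Real.log (rad a b c : ℝ) := Real.log_nonneg (by have := four_le_rad h hab hc3; linarith)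
  have hsub : (c * a).primeFactors ⊆ (a * b * c).primeFactors := by
    rw [Nat.primeFactors_mul hc0 ha0, Nat.primeFactors_mul (mul_ne_zero ha0 hb0) hc0,
      Nat.primeFactors_mul ha0 hb0]
    intro q hq
    rcases Finset.mem_union.mp hq with hq | hq
    · exact Finset.mem_union_right _ hq
    · exact Finset.mem_union_left _ (Finset.mem_union_left _ hq)
  have hsubb : b.primeFactors ⊆ (a * b * c).primeFactors := by
    rw [Nat.primeFactors_mul (mul_ne_zero ha0 hb0) hc0, Nat.primeFactors_mul ha0 hb0]
    exact (Finset.subset_union_right).trans Finset.subset_union_left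
  have hprime : ∀ q ∈ (c * a).primeFactors, q.Prime := fun q hq => Nat.prime_of_mem_primeFactors hq
  have heca : ∀ q ∈ (c * a).primeFactors, (|expDiff c a q| : ℝ) ≤ 6 * Real.log c := by
    intro q hq
    have := abs_expDiff_le hc0 ha0 hac.symm le_rfl (show a ≤ c by omega) q (Nat.prime_of_mem_primeFactors hq)
    linarith
  have key := log_le_of_kappaSlot hK (by linarith) hσ0 hP (four_le_rad h hab hc3) (by linarith)
    (expDiff c a) hb0 hodd (Nat.Coprime.mul_right hbc hcop.symm)
    (prod_le_rad_of_subset hsub) (prod_le_rad_of_subset hsubb) heca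
    (prod_zpow_expDiff_ne_one hc0 ha0 hac.symm (by omega))
    (fun p hp => by exact_mod_cast (padicValRat_route_b h hp).symm.le)
  exact slot_reshape hK (by linarith) (Real.rpow_nonneg (by positivity) _) (prod_log_nonneg hprime)
    (prod_log_le_prod_log_max_four hprime) (by positivity) le_rfl le_rfl (by rw [one_mul]; exact key)

/-- **The slot at `a`** (`a` odd; generators the primes of `cb`; congruence (12)). [folklore]
[cite: StewartYu1991, §3 (source FOLLOWED; preliminaries of the cell’s κ-door, NOT a printed statement)] -/
theorem slot_a (hK : 0 ≤ K) (hL : 1 ≤ L) (hσ0 : 0 ≤ σ)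
    (hP : ∀ p : ℕ, p.Prime → p ≠ 2 → FinBoundAt p K L κ' σ τ τ₁)
    (h : IsABCTriple a b c) (hab : a ≤ b) (hc3 : 3 ≤ c) (hodd : Odd a) :
    Real.log a ≤ (1 * K) * L ^ (c * b).primeFactors.card *
      ((((c * b).primeFactors.card : ℝ)) ^ (c * b).primeFactors.card) ^ κ' *
      (largestPrimeFactor a : ℝ) ^ σ * (∏ q ∈ (c * b).primeFactors, Real.log ((max 4 q : ℕ) : ℝ)) *
      (Real.log (6 * Real.log c) ^ τ * Real.log (rad a b c : ℝ) ^ τ₁ * Real.log (rad a b c : ℝ)) := by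
  obtain ⟨ha, hb, habc, hcop⟩ := id h
  have hc0 : c ≠ 0 := by omega
  have ha0 : a ≠ 0 := ha.ne'
  have hb0 : b ≠ 0 := hb.ne'
  have hac : a.Coprime c := coprime_left_of_isABCTriple h
  have hbc : b.Coprime c := coprime_right_of_isABCTriple h
  have hc3r : (3 : ℝ) ≤ c := by exact_mod_cast hc3
  have hlogc1 : 1 ≤ Real.log c := by
    rw [← Real.log_exp 1]; apply Real.log_le_log (Real.exp_pos 1); have := Real.exp_one_lt_d9; linarith
  have hl1 : 0 ≤ Real.log (6 * Real.log c) := Real.log_nonneg (by linarith)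
  have hl2 : 0 ≤ Real.log (rad a b c : ℝ) := Real.log_nonneg (by have := four_le_rad h hab hc3; linarith)
  have hsub : (c * b).primeFactors ⊆ (a * b * c).primeFactors := by
    rw [Nat.primeFactors_mul hc0 hb0, Nat.primeFactors_mul (mul_ne_zero ha0 hb0) hc0,
      Nat.primeFactors_mul ha0 hb0]
    intro q hq
    rcases Finset.mem_union.mp hq with hq | hq
    · exact Finset.mem_union_right _ hq
    · exact Finset.mem_union_left _ (Finset.mem_union_right _ hq)
  have hsuba : a.primeFactors ⊆ (a * b * c).primeFactors := by
    rw [Nat.primeFactors_mul (mul_ne_zero ha0 hb0) hc0, Nat.primeFactors_mul ha0 hb0]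
    exact (Finset.subset_union_left).trans Finset.subset_union_left
  have hprime : ∀ q ∈ (c * b).primeFactors, q.Prime := fun q hq => Nat.prime_of_mem_primeFactors hq
  have hecb : ∀ q ∈ (c * b).primeFactors, (|expDiff c b q| : ℝ) ≤ 6 * Real.log c := by
    intro q hq
    have := abs_expDiff_le hc0 hb0 hbc.symm le_rfl (show b ≤ c by omega) q (Nat.prime_of_mem_primeFactors hq)
    linarith
  have key := log_le_of_kappaSlot hK (by linarith) hσ0 hP (four_le_rad h hab hc3) (by linarith)
    (expDiff c b) ha0 hodd (Nat.Coprime.mul_right hac hcop)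
    (prod_le_rad_of_subset hsub) (prod_le_rad_of_subset hsuba) hecb
    (prod_zpow_expDiff_ne_one hc0 hb0 hbc.symm (by omega))
    (fun p hp => by exact_mod_cast (padicValRat_route_a h hp).symm.le)
  exact slot_reshape hK (by linarith) (Real.rpow_nonneg (by positivity) _) (prod_log_nonneg hprime)
    (prod_log_le_prod_log_max_four hprime) (by positivity) le_rfl le_rfl (by rw [one_mul]; exact key)

/-- **The archimedean slot** (`a² < b`): `log c ≤ 16·(2^{71})^{n'}·n'^{n'}·∏_{q∣cb} log max(4,q)·(log(6log c)·(log G)²)`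
(the tree's `log_le_of_archRoute` with Waldschmidt's PROVED Proposition 3.8). [folklore]
[cite: StewartYu1991, §3 (source FOLLOWED; preliminaries of the cell’s κ-door, NOT a printed statement)] -/
theorem slot_arch (h : IsABCTriple a b c) (hab : a ≤ b) (hc3 : 3 ≤ c) (hcase : a ^ 2 < b) :
    Real.log c ≤ 16 * (((2 : ℝ) ^ 71) ^ (c * b).primeFactors.card *
      (((c * b).primeFactors.card : ℝ)) ^ (c * b).primeFactors.card *
      (∏ q ∈ (c * b).primeFactors, Real.log ((max 4 q : ℕ) : ℝ)) *
      (Real.log (6 * Real.log c) * Real.log (rad a b c : ℝ) ^ 2)) := by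
  obtain ⟨ha, hb, habc, hcop⟩ := id h
  have hc0 : c ≠ 0 := by omega
  have ha0 : a ≠ 0 := ha.ne'
  have hb0 : b ≠ 0 := hb.ne'
  have hG4 := four_le_rad h hab hc3
  have hG0 : (0 : ℝ) < rad a b c := by linarith
  have hLG1 : 1 ≤ Real.log (rad a b c : ℝ) := by
    rw [← Real.log_exp 1]; apply Real.log_le_log (Real.exp_pos 1); have := Real.exp_one_lt_d9; linarith
  have h2LG : Real.log (2 * Real.log (rad a b c : ℝ)) ≤ Real.log (rad a b c : ℝ) := by
    have h1 : Real.log (rad a b c : ℝ) ≤ (rad a b c : ℝ) / 2 := by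
      have h := Real.log_le_sub_one_of_pos (show (0 : ℝ) < (rad a b c : ℝ) / 2 by linarith)
      rw [Real.log_div hG0.ne' two_ne_zero] at h
      have := Real.log_two_lt_d9
      linarith
    exact Real.log_le_log (by linarith) (by linarith)
  have hsub : (c * b).primeFactors ⊆ (a * b * c).primeFactors := by
    rw [Nat.primeFactors_mul hc0 hb0, Nat.primeFactors_mul (mul_ne_zero ha0 hb0) hc0,
      Nat.primeFactors_mul ha0 hb0]
    intro q hq
    rcases Finset.mem_union.mp hq with hq | hq
    · exact Finset.mem_union_right _ hq
    · exact Finset.mem_union_left _ (Finset.mem_union_right _ hq)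
  have hlog4G : ∀ q ∈ (c * b).primeFactors, Real.log ((max 4 q : ℕ) : ℝ) ≤ Real.log (rad a b c : ℝ) := by
    intro q hq
    apply Real.log_le_log (by exact_mod_cast lt_of_lt_of_le (by norm_num) (le_max_left 4 q))
    have : ((max 4 q : ℕ) : ℝ) = max (4 : ℝ) (q : ℝ) := by push_cast; rfl
    rw [this]
    refine max_le hG4 ?_
    have := prod_le_rad_of_subset (Finset.singleton_subset_iff.mpr (hsub hq))
    rwa [Finset.prod_singleton] at this
  have hncb1 : 1 ≤ (c * b).primeFactors.card :=
    Finset.card_pos.mpr ((Nat.nonempty_primeFactors.mpr (show 2 ≤ c by omega)).mono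
      (by rw [Nat.primeFactors_mul hc0 hb0]; exact Finset.subset_union_left))
  have hc₆C : 2 * |(2 : ℝ) ^ 70| ≤ (2 : ℝ) ^ 71 := by rw [abs_of_pos (by positivity)]; norm_num
  have hCr1 : (1 : ℝ) ≤ 2 ^ 71 * ((c * b).primeFactors.card : ℝ) := by
    have : (1 : ℝ) ≤ (c * b).primeFactors.card := by exact_mod_cast hncb1
    nlinarith
  have key := log_le_of_archRoute w80Cw (2 ^ 70) w80Cw_nonneg (fun n => w80Cw_le n) waldschmidt1980_hW₂
    hc₆C hCr1 hLG1 h2LG h hab hc3 hcase le_rfl hlog4G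
  rw [mul_pow] at key
  convert key using 2

end Slots

/-! ### Absorptions and shared book-keeping -/

/-- Chebyshev absorption with the top prime of a member `w` whose primes lie in `T₀ ⊆ S`. [folklore]
[cite: StewartYu1991, §3 (source FOLLOWED; preliminaries of the cell’s κ-door, NOT a printed statement)] -/
theorem absorb_top {S T₀ : Finset ℕ} {LG : ℝ} (hSprime : ∀ q ∈ S, q.Prime)
    (hlog4 : ∀ q ∈ S, Real.log ((max 4 q : ℕ) : ℝ) ≤ LG) (hLG1 : 1 ≤ LG) (w : ℕ)
    (hSwT : w.primeFactors ⊆ T₀) (hT₀S : T₀ ⊆ S) :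
    (T₀.card : ℝ) ^ T₀.card * (largestPrimeFactor w : ℝ) * ∏ q ∈ T₀, Real.log ((max 4 q : ℕ) : ℝ) ≤
      600 ^ (T₀.card + 1) * (∏ q ∈ T₀, (q : ℝ)) * LG ^ 3 := by
  have hT₀prime : ∀ q ∈ T₀, q.Prime := fun q hq => hSprime q (hT₀S hq)
  have h1 := pow_card_mul_prod_top_mul_prod_log_le hT₀prime
    (T := w.primeFactors.filter (fun q => q = largestPrimeFactor w)) ((Finset.filter_subset _ _).trans hSwT)
    ((card_filter_eq_largestPrimeFactor_le w).trans (by norm_num)) hLG1 (fun q hq => hlog4 q (hT₀S hq))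
  rwa [prod_filter_eq_largestPrimeFactor] at h1

/-- Chebyshev absorption without a top prime. [folklore]
[cite: StewartYu1991, §3 (source FOLLOWED; preliminaries of the cell’s κ-door, NOT a printed statement)] -/
theorem absorb_none {S T₀ : Finset ℕ} {LG : ℝ} (hSprime : ∀ q ∈ S, q.Prime)
    (hlog4 : ∀ q ∈ S, Real.log ((max 4 q : ℕ) : ℝ) ≤ LG) (hLG1 : 1 ≤ LG) (hT₀S : T₀ ⊆ S) :
    (T₀.card : ℝ) ^ T₀.card * ∏ q ∈ T₀, Real.log ((max 4 q : ℕ) : ℝ) ≤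
      600 ^ (T₀.card + 1) * (∏ q ∈ T₀, (q : ℝ)) * LG ^ 3 := by
  have hT₀prime : ∀ q ∈ T₀, q.Prime := fun q hq => hSprime q (hT₀S hq)
  have h1 := pow_card_mul_prod_top_mul_prod_log_le hT₀prime (T := ∅) (Finset.empty_subset _)
    (by rw [Finset.card_empty]; norm_num) hLG1 (fun q hq => hlog4 q (hT₀S hq))
  rw [Finset.prod_empty, mul_one] at h1
  exact h1

/-- `n^n ≤ W` and `n₁^{n₁} n₂^{n₂} ≤ W²` from `r^r ≤ W`, `nᵢ ≤ r`, `n₁ + n₂ ≤ 2r`. [folklore]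
[cite: StewartYu1991, §3 (source FOLLOWED; preliminaries of the cell’s κ-door, NOT a printed statement)] -/
theorem pow_self_le_of_le {n r : ℕ} {W : ℝ} (hrr : ((r : ℝ)) ^ r ≤ W) (hr1 : 1 ≤ r) (hn : n ≤ r) :
    ((n : ℝ)) ^ n ≤ W := by
  have hr1R : (1 : ℝ) ≤ r := by exact_mod_cast hr1
  calc ((n : ℝ)) ^ n ≤ (r : ℝ) ^ n := pow_le_pow_left₀ (Nat.cast_nonneg _) (by exact_mod_cast hn) n
    _ ≤ (r : ℝ) ^ r := pow_le_pow_right₀ hr1R hn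
    _ ≤ W := hrr

/-- See `pow_self_le_of_le`. [folklore]
[cite: StewartYu1991, §3 (source FOLLOWED; preliminaries of the cell’s κ-door, NOT a printed statement)] -/
theorem pow_self_mul_le_sq {n₁ n₂ r : ℕ} {W : ℝ} (hrr : ((r : ℝ)) ^ r ≤ W) (hr1 : 1 ≤ r)
    (h1 : n₁ ≤ r) (h2 : n₂ ≤ r) (h12 : n₁ + n₂ ≤ 2 * r) :
    ((n₁ : ℝ)) ^ n₁ * ((n₂ : ℝ)) ^ n₂ ≤ W ^ 2 := by
  have hr1R : (1 : ℝ) ≤ r := by exact_mod_cast hr1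
  calc ((n₁ : ℝ)) ^ n₁ * ((n₂ : ℝ)) ^ n₂ ≤ (r : ℝ) ^ n₁ * (r : ℝ) ^ n₂ :=
        mul_le_mul (pow_le_pow_left₀ (Nat.cast_nonneg _) (by exact_mod_cast h1) n₁)
          (pow_le_pow_left₀ (Nat.cast_nonneg _) (by exact_mod_cast h2) n₂)
          (pow_nonneg (Nat.cast_nonneg _) _) (pow_nonneg (Nat.cast_nonneg _) _)
    _ = (r : ℝ) ^ (n₁ + n₂) := (pow_add _ _ _).symm
    _ ≤ (r : ℝ) ^ (2 * r) := pow_le_pow_right₀ hr1R h12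
    _ = ((r : ℝ) ^ r) ^ 2 := by rw [← pow_mul, mul_comm]
    _ ≤ W ^ 2 := pow_le_pow_left₀ (pow_nonneg (Nat.cast_nonneg _) _) hrr 2

/-- **The final shape**: monotone book-keeping of the constants. [folklore]
[cite: StewartYu1991, §3 (source FOLLOWED; preliminaries of the cell’s κ-door, NOT a printed statement)] -/
theorem final_shape {K A M M₀ G Wκ LG Lc Yx u : ℝ} {r τ τ₁ : ℕ}
    (hA : A ≤ 128 * max 1 K ^ 2) (hM1 : 1 ≤ M) (hM : M ≤ M₀) (hYx0 : 0 ≤ Yx)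
    (hYx : Yx ≤ 4 * (LG ^ (2 * τ₁ + 3) * Lc ^ (2 * τ + 1))) (hWκ : 0 ≤ Wκ)
    (hmain : u ^ 2 ≤ A * (600 * M) ^ (2 * r) * 600 ^ 2 * G ^ 2 * Wκ * LG ^ 6 * Yx) :
    u ^ 2 ≤ 512 * max 1 K ^ 2 * (600 * M₀) ^ (2 * r) * 600 ^ 2 * G ^ 2 * Wκ *
      LG ^ (2 * τ₁ + 9) * Lc ^ (2 * τ + 1) := by
  have hM₀0 : 0 < M₀ := by linarith
  have hM' : (600 * M) ^ (2 * r) ≤ (600 * M₀) ^ (2 * r) :=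
    pow_le_pow_left₀ (by linarith) (by linarith) _
  have e : 512 * max 1 K ^ 2 * (600 * M₀) ^ (2 * r) * 600 ^ 2 * G ^ 2 * Wκ *
      LG ^ (2 * τ₁ + 9) * Lc ^ (2 * τ + 1) =
      (128 * max 1 K ^ 2) * (600 * M₀) ^ (2 * r) * 600 ^ 2 * G ^ 2 * Wκ * LG ^ 6 *
        (4 * (LG ^ (2 * τ₁ + 3) * Lc ^ (2 * τ + 1))) := by ring
  rw [e]
  refine hmain.trans ?_
  have h0 : 0 ≤ (128 * max 1 K ^ 2) * (600 * M₀) ^ (2 * r) * 600 ^ 2 * G ^ 2 * Wκ * LG ^ 6 := by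
    positivity
  refine mul_le_mul ?_ hYx hYx0 h0
  exact mul_le_mul_of_nonneg_right (mul_le_mul_of_nonneg_right (mul_le_mul_of_nonneg_right
    (mul_le_mul_of_nonneg_right (mul_le_mul hA hM' (by positivity) (by positivity)) (by positivity))
    (by positivity)) hWκ) (by positivity)

end KappaDoor

end Literature.NumberTheory.Transcendental.StewartYu

end Part3

/-!
## Part 4 — port of `Summits/ABC/StewartYu/KappaDoorEven.lean`

# Cell abc-stewartyu, the κ-DOOR, IIIa: the two-slot inequality for an abc triple, `c` even

`Summits/ABC/StewartYu/KappaDoorEven.lean` — cell `abc-stewartyu` (HOME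
`run/shared/lean/pub/abc-stewartyu/`, seat p3; HOME/plan/KAPPA-DOOR-RECIPE.md; theorems only).

For an abc triple `a + b = c` (`a ≤ b`, `c ≥ 3`) and a `p`-adic input of shape
`K·Lⁿ·n^{κ'n}·p^σ·…` at every ODD prime (`κ' ≥ 1`, `0 ≤ σ ≤ 2`), exactly one member is even, and
the two odd members carry `p`-adic slots (`KappaDoorSlot.log_le_of_kappaSlot`); when the small member
`a` is one of them and `a² < b`, its slot is replaced by the ARCHIMEDEAN slot on `log c`
(the tree's `log_le_of_archRoute` with Waldschmidt 1980 PROVED, `waldschmidt1980_hW₂`).  Multiplying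
the two slots and absorbing `n^n`, the two top primes and the small logarithms by Chebyshev
(`pow_card_mul_prod_top_mul_prod_log_le`, `card_pow_card_le_rad`) exactly as in (17)–(18) of the
printed line [cite: StewartYu1991, (17)–(18)] gives

  `(log c)² ≤ 512·max(1,K)²·(600 M₀)^{2r}·600²·G²·(W²)^{κ'−1}·(log G)^{2τ₁+9}·(log(6 log c))^{2τ+1}`,

`r = ω(abc)`, `G = rad(abc)`, `W = 600^{r+1} G`, `M₀ = max(L, 2^{71})` (`log_sq_le_of_finBound`).
The `ε`-endgame is in `KappaDoor.lean`. Everything is [folklore] book-keeping.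
-/

section Part4

open _root_.Finset _root_.Real
open Literature.NumberTheory.DiophantineGeometry
open Literature.NumberTheory.DiophantineGeometry.Pasten
open Literature.NumberTheory.Transcendental.Waldschmidt1980 (w80Cw w80Cw_nonneg w80Cw_le waldschmidt1980_hW₂)
open Literature.Barriers.ABC

namespace Literature.NumberTheory.Transcendental.StewartYu

namespace KappaDoor

set_option maxHeartbeats 1600000 in
/-- **The two-slot inequality when `c` is even** (slots at the odd members `a`, `b`; the archimedean slot replaces `a` when `a² < b`): see `KappaDoor.log_sq_le_of_finBound`. [folklore]
[cite: StewartYu1991, §3 (source FOLLOWED; the cell’s κ-door, even case, NOT a printed statement)] -/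
theorem log_sq_le_of_finBound_even {K L κ' σ : ℝ} {τ τ₁ : ℕ} (hK : 0 ≤ K) (hL : 1 ≤ L) (hκ' : 1 ≤ κ')
    (hσ0 : 0 ≤ σ) (hσ : σ ≤ 2) (hP : ∀ p : ℕ, p.Prime → p ≠ 2 → FinBoundAt p K L κ' σ τ τ₁)
    {a b c : ℕ} (h : IsABCTriple a b c) (hab : a ≤ b) (hc3 : 3 ≤ c) (hc_even : Even c) :
    Real.log c ^ 2 ≤ 512 * max 1 K ^ 2 * (600 * max L (2 ^ 71)) ^ (2 * (a * b * c).primeFactors.card) *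
      600 ^ 2 * (rad a b c : ℝ) ^ 2 *
      (((600 : ℝ) ^ ((a * b * c).primeFactors.card + 1) * (rad a b c : ℝ)) ^ 2) ^ (κ' - 1) *
      Real.log (rad a b c : ℝ) ^ (2 * τ₁ + 9) * Real.log (6 * Real.log c) ^ (2 * τ + 1) := by
  classical
  obtain ⟨ha, hb, habc, hcop⟩ := id h
  have hc0 : c ≠ 0 := by omega
  have ha0 : a ≠ 0 := ha.ne'
  have hb0 : b ≠ 0 := hb.ne'
  have hb2 : 2 ≤ b := by
    by_contra hlt
    have hb1 : b = 1 := by omega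
    have ha1 : a = 1 := by omega
    omega
  have hneq : a ≠ b := by
    intro heq
    rw [heq] at hcop
    have : b = 1 := by simpa using hcop
    omega
  have hac : a.Coprime c := coprime_left_of_isABCTriple h
  have hbc : b.Coprime c := coprime_right_of_isABCTriple h
  have hac_le : a ≤ c := by omega
  have hbc_le : b ≤ c := by omega
  -- the sets of primes
  set Sa := a.primeFactors with hSa
  set Sb := b.primeFactors with hSb
  set Sc := c.primeFactors with hSc
  set S := (a * b * c).primeFactors with hS
  set r : ℕ := S.card with hr
  have hSab : (a * b).primeFactors = Sa ∪ Sb := Nat.primeFactors_mul ha0 hb0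
  have hSca : (c * a).primeFactors = Sc ∪ Sa := Nat.primeFactors_mul hc0 ha0
  have hScb : (c * b).primeFactors = Sc ∪ Sb := Nat.primeFactors_mul hc0 hb0
  have hSabc : S = Sa ∪ Sb ∪ Sc := by
    rw [hS, Nat.primeFactors_mul (mul_ne_zero ha0 hb0) hc0, hSab]
  have hdab : Disjoint Sa Sb := hcop.disjoint_primeFactors
  have hdac : Disjoint Sa Sc := hac.disjoint_primeFactors
  have hdbc : Disjoint Sb Sc := hbc.disjoint_primeFactors
  have hSaS : Sa ⊆ S := by rw [hSabc]; exact Finset.subset_union_left.trans Finset.subset_union_left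
  have hSbS : Sb ⊆ S := by rw [hSabc]; exact Finset.subset_union_right.trans Finset.subset_union_left
  have hScS : Sc ⊆ S := by rw [hSabc]; exact Finset.subset_union_right
  have hSprime : ∀ q ∈ S, q.Prime := fun q hq => Nat.prime_of_mem_primeFactors hq
  have hSaprime : ∀ q ∈ Sa, q.Prime := fun q hq => Nat.prime_of_mem_primeFactors hq
  have hSbprime : ∀ q ∈ Sb, q.Prime := fun q hq => Nat.prime_of_mem_primeFactors hq
  have hScprime : ∀ q ∈ Sc, q.Prime := fun q hq => Nat.prime_of_mem_primeFactors hq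
  have hrsum : r = Sa.card + Sb.card + Sc.card := by
    rw [hr, hSabc, Finset.card_union_of_disjoint (Finset.disjoint_union_left.mpr ⟨hdac, hdbc⟩),
      Finset.card_union_of_disjoint hdab]
  have hSbne : Sb.Nonempty := Nat.nonempty_primeFactors.mpr (by omega)
  have hScne : Sc.Nonempty := Nat.nonempty_primeFactors.mpr (by omega)
  have hr1 : 1 ≤ r := by rw [hr]; exact Finset.card_pos.mpr (hScne.mono hScS)
  -- the radical and its factors
  set ρa : ℝ := ∏ q ∈ Sa, (q : ℝ) with hρa
  set ρb : ℝ := ∏ q ∈ Sb, (q : ℝ) with hρb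
  set ρc : ℝ := ∏ q ∈ Sc, (q : ℝ) with hρc
  have hρa1 : 1 ≤ ρa := by
    rw [hρa, ← Nat.cast_prod]; exact_mod_cast Finset.prod_pos fun q hq => (hSaprime q hq).pos
  have hρb1 : 1 ≤ ρb := by
    rw [hρb, ← Nat.cast_prod]; exact_mod_cast Finset.prod_pos fun q hq => (hSbprime q hq).pos
  have hρc1 : 1 ≤ ρc := by
    rw [hρc, ← Nat.cast_prod]; exact_mod_cast Finset.prod_pos fun q hq => (hScprime q hq).pos
  set G : ℝ := (rad a b c : ℝ) with hGdef
  have hradS : rad a b c = ∏ q ∈ S, q := by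
    rw [rad_def, Nat.radical_eq_prod_primeFactors]
  have hGprod : G = ∏ q ∈ S, (q : ℝ) := by rw [hGdef, hradS]; push_cast; rfl
  have hGabc : G = ρa * ρb * ρc := by
    rw [hGprod, hSabc, Finset.prod_union (Finset.disjoint_union_left.mpr ⟨hdac, hdbc⟩),
      Finset.prod_union hdab]
  have hG4 : (4 : ℝ) ≤ G := four_le_rad h hab hc3
  have hG1 : (1 : ℝ) ≤ G := by linarith
  have hG0 : (0 : ℝ) < G := by linarith
  have hρa0 : 0 ≤ ρa := by linarith
  have hρb0 : 0 ≤ ρb := by linarith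
  have hρc0 : 0 ≤ ρc := by linarith
  -- products over the generator sets
  have hPab : ∏ q ∈ (a * b).primeFactors, (q : ℝ) = ρa * ρb := by rw [hSab, Finset.prod_union hdab]
  have hPca : ∏ q ∈ (c * a).primeFactors, (q : ℝ) = ρc * ρa := by rw [hSca, Finset.prod_union hdac.symm]
  have hPcb : ∏ q ∈ (c * b).primeFactors, (q : ℝ) = ρc * ρb := by rw [hScb, Finset.prod_union hdbc.symm]
  have hPa_ : ∏ p ∈ a.primeFactors, (p : ℝ) = ρa := rfl
  have hPb_ : ∏ p ∈ b.primeFactors, (p : ℝ) = ρb := rfl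
  have hPc_ : ∏ p ∈ c.primeFactors, (p : ℝ) = ρc := rfl
  -- logarithms
  set LG : ℝ := Real.log G with hLG
  have hLG1 : 1 ≤ LG := by
    rw [hLG, ← Real.log_exp 1]
    apply Real.log_le_log (Real.exp_pos 1)
    have := Real.exp_one_lt_d9; linarith
  have hLG0 : 0 ≤ LG := by linarith
  have hqG : ∀ q ∈ S, (q : ℝ) ≤ G := by
    intro q hq
    have h1 : q ∣ ∏ x ∈ S, x := Finset.dvd_prod_of_mem _ hq
    have h2 : q ≤ rad a b c := by
      rw [hradS]; exact Nat.le_of_dvd (Finset.prod_pos fun x hx => (hSprime x hx).pos) h1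
    rw [hGdef]; exact_mod_cast h2
  have hlog4G : ∀ q ∈ S, Real.log ((max 4 q : ℕ) : ℝ) ≤ LG := by
    intro q hq
    apply Real.log_le_log (by exact_mod_cast lt_of_lt_of_le (by norm_num) (le_max_left 4 q))
    have : ((max 4 q : ℕ) : ℝ) = max (4 : ℝ) (q : ℝ) := by push_cast; rfl
    rw [this]; exact max_le hG4 (hqG q hq)
  set Lc : ℝ := Real.log (6 * Real.log c) with hLc
  have hc3r : (3 : ℝ) ≤ c := by exact_mod_cast hc3
  have hlogc1 : 1 ≤ Real.log c := by
    rw [← Real.log_exp 1]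
    apply Real.log_le_log (Real.exp_pos 1)
    have := Real.exp_one_lt_d9; linarith
  have hlogc0 : 0 ≤ Real.log c := by linarith
  have hB3 : (3 : ℝ) ≤ 6 * Real.log c := by linarith
  have hLc1 : 1 ≤ Lc := by
    rw [hLc, ← Real.log_exp 1]
    apply Real.log_le_log (Real.exp_pos 1)
    have := Real.exp_one_lt_d9; linarith
  have hLc0 : 0 ≤ Lc := by linarith
  -- the slot bundle `Y₀ = Lc^τ LG^{τ₁} LG` and the final bundle
  set Y₀ : ℝ := Lc ^ τ * LG ^ τ₁ * LG with hY₀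
  have hY₀0 : 0 ≤ Y₀ := by positivity
  have hY₀1 : 1 ≤ Y₀ := one_le_mul_of_one_le_of_one_le (one_le_mul_of_one_le_of_one_le
    (one_le_pow₀ hLc1) (one_le_pow₀ hLG1)) hLG1
  set Yt : ℝ := LG ^ (2 * τ₁ + 3) * Lc ^ (2 * τ + 1) with hYt
  have hYsq : Y₀ ^ 2 ≤ Yt := by
    have e : Y₀ ^ 2 = LG ^ (2 * τ₁ + 2) * Lc ^ (2 * τ) := by rw [hY₀]; ring
    rw [e, hYt]
    exact mul_le_mul (pow_le_pow_right₀ hLG1 (by omega)) (pow_le_pow_right₀ hLc1 (by omega))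
      (by positivity) (by positivity)
  have hYarch : (4 * Y₀) * (Lc * LG ^ 2) ≤ 4 * Yt := by
    have e : (4 * Y₀) * (Lc * LG ^ 2) = 4 * (LG ^ (τ₁ + 3) * Lc ^ (τ + 1)) := by rw [hY₀]; ring
    rw [e, hYt]
    refine mul_le_mul_of_nonneg_left ?_ (by norm_num)
    exact mul_le_mul (pow_le_pow_right₀ hLG1 (by omega)) (pow_le_pow_right₀ hLc1 (by omega))
      (by positivity) (by positivity)
  -- constants
  set M₀ : ℝ := max L (2 ^ 71) with hM₀
  have hLM : L ≤ M₀ := le_max_left _ _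
  have hCM : (2 : ℝ) ^ 71 ≤ M₀ := le_max_right _ _
  have hL0 : 0 ≤ L := by linarith
  set W : ℝ := 600 ^ (r + 1) * G with hW
  have hW1 : 1 ≤ W := one_le_mul_of_one_le_of_one_le (one_le_pow₀ (by norm_num)) hG1
  have hrr : ((r : ℝ)) ^ r ≤ W := by rw [hW, hGdef, hr]; exact card_pow_card_le_rad a b c
  -- cardinalities
  have hnab : (a * b).primeFactors.card = Sa.card + Sb.card := by
    rw [hSab, Finset.card_union_of_disjoint hdab]
  have hnca : (c * a).primeFactors.card = Sc.card + Sa.card := by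
    rw [hSca, Finset.card_union_of_disjoint hdac.symm]
  have hncb : (c * b).primeFactors.card = Sc.card + Sb.card := by
    rw [hScb, Finset.card_union_of_disjoint hdbc.symm]
  -- top primes
  have hPa1 : (1 : ℝ) ≤ largestPrimeFactor a := by exact_mod_cast one_le_largestPrimeFactor a
  have hPb1 : (1 : ℝ) ≤ largestPrimeFactor b := by exact_mod_cast one_le_largestPrimeFactor b
  have hPc1 : (1 : ℝ) ≤ largestPrimeFactor c := by exact_mod_cast one_le_largestPrimeFactor c
  have hPle : ∀ {w : ℕ} (Sw : Finset ℕ), Sw = w.primeFactors → (largestPrimeFactor w : ℝ) ≤ ∏ q ∈ Sw, (q : ℝ) := by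
    intro w Sw hSw
    rw [hSw, ← prod_filter_eq_largestPrimeFactor w]
    rw [← Nat.cast_prod, ← Nat.cast_prod]
    exact_mod_cast Finset.prod_le_prod_of_subset_of_one_le' (Finset.filter_subset _ _)
      fun q hq _ => (Nat.prime_of_mem_primeFactors hq).one_lt.le
  have hPaρ : (largestPrimeFactor a : ℝ) ≤ ρa := hPle Sa rfl
  have hPbρ : (largestPrimeFactor b : ℝ) ≤ ρb := hPle Sb rfl
  have hPcρ : (largestPrimeFactor c : ℝ) ≤ ρc := hPle Sc rfl
  have hSabS : (a * b).primeFactors ⊆ S := by rw [hSab]; exact Finset.union_subset hSaS hSbS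
  have hScaS : (c * a).primeFactors ⊆ S := by rw [hSca]; exact Finset.union_subset hScS hSaS
  have hScbS : (c * b).primeFactors ⊆ S := by rw [hScb]; exact Finset.union_subset hScS hSbS
  have hmK : (1 : ℝ) ≤ max 1 K := le_max_left _ _
  have hKm : K ≤ max 1 K := le_max_right _ _
  -- ### the common final shape
  have hWκ : 0 ≤ (W ^ 2) ^ (κ' - 1) := Real.rpow_nonneg (by positivity) _
  have hYt0 : 0 ≤ Yt := by positivity
  have hfin : ∀ {A M Yx : ℝ}, A ≤ 128 * max 1 K ^ 2 → 1 ≤ M → M ≤ M₀ → 0 ≤ Yx → Yx ≤ 4 * Yt →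
      Real.log c ^ 2 ≤ A * (600 * M) ^ (2 * r) * 600 ^ 2 * G ^ 2 * (W ^ 2) ^ (κ' - 1) * LG ^ 6 * Yx →
      Real.log c ^ 2 ≤ 512 * max 1 K ^ 2 * (600 * M₀) ^ (2 * r) * 600 ^ 2 * G ^ 2 *
        (W ^ 2) ^ (κ' - 1) * LG ^ (2 * τ₁ + 9) * Lc ^ (2 * τ + 1) :=
    fun hA hM1 hM hYx0 hYx hmain => final_shape hA hM1 hM hYx0 (by rw [hYt] at hYx; exact hYx) hWκ hmain
  -- sizes used repeatedly
  have hloga0 : 0 ≤ Real.log a := Real.log_nonneg (by exact_mod_cast ha)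
  have hlogb0 : 0 ≤ Real.log b := Real.log_nonneg (by exact_mod_cast hb)
  have hmsq : max 1 K ≤ max 1 K ^ 2 := le_self_pow₀ hmK two_ne_zero
  have hK16 : 16 * K ≤ 128 * max 1 K ^ 2 := by
    calc 16 * K ≤ 16 * max 1 K := mul_le_mul_of_nonneg_left hKm (by norm_num)
      _ ≤ 16 * max 1 K ^ 2 := mul_le_mul_of_nonneg_left hmsq (by norm_num)
      _ ≤ 128 * max 1 K ^ 2 := by
          have : 0 ≤ max 1 K ^ 2 := by positivity
          linarith only [this]
  have hKsq : K ^ 2 ≤ max 1 K ^ 2 := pow_le_pow_left₀ hK hKm 2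
  have hm2 : 0 ≤ max 1 K ^ 2 := by positivity
  have hK32 : 32 * K ^ 2 ≤ 128 * max 1 K ^ 2 := by linarith only [hKsq, hm2]
  have hK8 : 8 * K ^ 2 ≤ 128 * max 1 K ^ 2 := by linarith only [hKsq, hm2]
  have hK4 : 4 * K ^ 2 ≤ 128 * max 1 K ^ 2 := by linarith only [hKsq, hm2]
  have hM₀1 : 1 ≤ M₀ := hL.trans hLM
  have hΩ4_0 : ∀ U : Finset ℕ, 0 ≤ ∏ q ∈ U, Real.log ((max 4 q : ℕ) : ℝ) := fun U =>
    zero_le_one.trans (one_le_prod_log_max_four U)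
  have hcardab : (a * b).primeFactors.card ≤ r := by rw [hnab, hrsum]; omega
  have hcardca : (c * a).primeFactors.card ≤ r := by rw [hnca, hrsum]; omega
  have hcardcb : (c * b).primeFactors.card ≤ r := by rw [hncb, hrsum]; omega
  have hG2 : G ^ 2 = (ρa * ρb * ρc) ^ 2 := by rw [hGabc]
  have hfold : Real.log (6 * Real.log c) ^ τ * Real.log (rad a b c : ℝ) ^ τ₁ * Real.log (rad a b c : ℝ) = Y₀ := by
    rw [hY₀, hLc, hLG]
  have hfold2 : Real.log (6 * Real.log c) * Real.log (rad a b c : ℝ) ^ 2 = Lc * LG ^ 2 := by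
    rw [hLc, hLG]
  have slotC : Odd c → Real.log c ≤ (1 * K) * L ^ (a * b).primeFactors.card *
      ((((a * b).primeFactors.card : ℝ)) ^ (a * b).primeFactors.card) ^ κ' *
      (largestPrimeFactor c : ℝ) ^ σ * (∏ q ∈ (a * b).primeFactors, Real.log ((max 4 q : ℕ) : ℝ)) * Y₀ :=
    fun hodd => by have := slot_c hK hL hσ0 hP h hab hc3 hodd; rwa [hfold] at this
  have hlogcb : Real.log c ≤ 4 * Real.log b := by
    have h2b : (c : ℝ) ≤ 2 * b := by exact_mod_cast (show c ≤ 2 * b by omega)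
    have hb2r : (2 : ℝ) ≤ b := by exact_mod_cast hb2
    have hlog2b : Real.log 2 ≤ Real.log b := Real.log_le_log two_pos hb2r
    calc Real.log c ≤ Real.log (2 * b) := Real.log_le_log (by positivity) h2b
      _ = Real.log 2 + Real.log b := Real.log_mul two_ne_zero (by positivity)
      _ ≤ 4 * Real.log b := by linarith [Real.log_nonneg (by linarith : (1:ℝ) ≤ b)]
  have slotB : Odd b → Real.log b ≤ (1 * K) * L ^ (c * a).primeFactors.card *
      ((((c * a).primeFactors.card : ℝ)) ^ (c * a).primeFactors.card) ^ κ' *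
      (largestPrimeFactor b : ℝ) ^ σ * (∏ q ∈ (c * a).primeFactors, Real.log ((max 4 q : ℕ) : ℝ)) * Y₀ :=
    fun hodd => by have := slot_b hK hL hσ0 hP h hab hc3 hodd; rwa [hfold] at this
  have slotA : Odd a → Real.log a ≤ (1 * K) * L ^ (c * b).primeFactors.card *
      ((((c * b).primeFactors.card : ℝ)) ^ (c * b).primeFactors.card) ^ κ' *
      (largestPrimeFactor a : ℝ) ^ σ * (∏ q ∈ (c * b).primeFactors, Real.log ((max 4 q : ℕ) : ℝ)) * Y₀ :=
    fun hodd => by have := slot_a hK hL hσ0 hP h hab hc3 hodd; rwa [hfold] at this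
  have slotArch : a ^ 2 < b → Real.log c ≤ 16 * (((2 : ℝ) ^ 71) ^ (c * b).primeFactors.card *
      (((c * b).primeFactors.card : ℝ)) ^ (c * b).primeFactors.card *
      (∏ q ∈ (c * b).primeFactors, Real.log ((max 4 q : ℕ) : ℝ)) * (Lc * LG ^ 2)) :=
    fun hcase => by have := slot_arch h hab hc3 hcase; rwa [hfold2] at this
  -- ### parity: exactly one member is even
  have hodd_of : ∀ {x y : ℕ}, x.Coprime y → Even x → Odd y := by
    intro x y hxy hx
    by_contra hy
    rw [Nat.not_odd_iff_even] at hy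
    have h2 : 2 ∣ Nat.gcd x y := Nat.dvd_gcd (even_iff_two_dvd.mp hx) (even_iff_two_dvd.mp hy)
    rw [hxy.gcd_eq_one] at h2
    omega
  -- `c` even ⇒ `a`, `b` odd
  have ha_odd : Odd a := hodd_of hac.symm hc_even
  have hb_odd : Odd b := hodd_of hbc.symm hc_even
  have hB := slotB hb_odd
  rw [one_mul] at hB
  by_cases hcase : a ^ 2 < b
  · -- slot at `b` (for `log c ≤ 4 log b`) × archimedean slot
    have hA := slotArch hcase
    have h₁ : Real.log c ≤ K * L ^ (c * a).primeFactors.card *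
        ((((c * a).primeFactors.card : ℝ)) ^ (c * a).primeFactors.card) ^ κ' *
        (largestPrimeFactor b : ℝ) ^ σ * (∏ q ∈ (c * a).primeFactors, Real.log ((max 4 q : ℕ) : ℝ)) *
        (4 * Y₀) := by
      refine hlogcb.trans ?_
      calc 4 * Real.log b ≤ 4 * (K * L ^ (c * a).primeFactors.card *
          ((((c * a).primeFactors.card : ℝ)) ^ (c * a).primeFactors.card) ^ κ' *
          (largestPrimeFactor b : ℝ) ^ σ * (∏ q ∈ (c * a).primeFactors, Real.log ((max 4 q : ℕ) : ℝ)) * Y₀) :=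
            mul_le_mul_of_nonneg_left hB (by norm_num)
        _ = _ := by ring
    have habs := absorb_none hSprime hlog4G hLG1 hScaS
    have habs' := absorb_top (T₀ := (c * b).primeFactors) hSprime hlog4G hLG1 b (by rw [hScb]; exact Finset.subset_union_right) hScbS
    rw [hPca] at habs
    rw [hPcb] at habs'
    have hGρ : ρc * ρa * (ρc * ρb) * ρb ≤ G ^ 2 := by
      rw [hG2]
      have hsq : ρa ≤ ρa ^ 2 := le_self_pow₀ hρa1 two_ne_zero
      calc ρc * ρa * (ρc * ρb) * ρb = ρa * (ρb ^ 2 * ρc ^ 2) := by ring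
        _ ≤ ρa ^ 2 * (ρb ^ 2 * ρc ^ 2) := mul_le_mul_of_nonneg_right hsq (by positivity)
        _ = (ρa * ρb * ρc) ^ 2 := by ring
    have key := slot_arch_bound (K := K) (L := L) (C := (2 : ℝ) ^ 71) (M₀ := M₀) (κ' := κ') (σ := σ)
      (u := Real.log c) (N := (((c * a).primeFactors.card : ℝ)) ^ (c * a).primeFactors.card)
      (N' := (((c * b).primeFactors.card : ℝ)) ^ (c * b).primeFactors.card)
      (P := (largestPrimeFactor b : ℝ)) (Ω := ∏ q ∈ (c * a).primeFactors, Real.log ((max 4 q : ℕ) : ℝ))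
      (Ω' := ∏ q ∈ (c * b).primeFactors, Real.log ((max 4 q : ℕ) : ℝ)) (Y := 4 * Y₀) (Y' := Lc * LG ^ 2)
      (R := ρc * ρa) (R' := ρc * ρb) (ρ := ρb) (Λ := LG) (G := G) (W := W)
      (n := (c * a).primeFactors.card) (n' := (c * b).primeFactors.card) (r := r)
      hK hL (by norm_num) hLM hCM hκ' hσ hlogc0
      (one_le_pow_self _) (pow_nonneg (Nat.cast_nonneg _) _) hPb1 (hΩ4_0 _) (hΩ4_0 _)
      (by positivity) (by positivity) (by positivity) (by positivity) hLG0 hW1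
      h₁ hA habs habs' hPbρ hGρ (pow_self_le_of_le hrr hr1 hcardca) (by rw [hnca, hncb, hrsum]; omega)
    refine hfin hK16 hM₀1 le_rfl (by positivity) ?_ key
    calc 4 * Y₀ * (Lc * LG ^ 2) = (4 * Y₀) * (Lc * LG ^ 2) := by ring
      _ ≤ 4 * Yt := hYarch
  · -- two slots: `a` (`log c ≤ 8 log a`) and `b` (`log c ≤ 4 log b`)
    push Not at hcase
    have hA := slotA ha_odd
    rw [one_mul] at hA
    have hloga : Real.log c ≤ 8 * Real.log a := by
      have h1 : (b : ℝ) ≤ (a : ℝ) ^ 2 := by exact_mod_cast hcase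
      have h2 : Real.log b ≤ 2 * Real.log a := by
        have e : Real.log ((a : ℝ) ^ 2) = 2 * Real.log a := by rw [Real.log_pow]; norm_num
        rw [← e]
        exact Real.log_le_log (by exact_mod_cast hb) h1
      calc Real.log c ≤ 4 * Real.log b := hlogcb
        _ ≤ 4 * (2 * Real.log a) := mul_le_mul_of_nonneg_left h2 (by norm_num)
        _ = 8 * Real.log a := by ring
    have habs₁ := absorb_top (T₀ := (c * b).primeFactors) hSprime hlog4G hLG1 b (by rw [hScb]; exact Finset.subset_union_right) hScbS
    have habs₂ := absorb_top (T₀ := (c * a).primeFactors) hSprime hlog4G hLG1 a (by rw [hSca]; exact Finset.subset_union_right) hScaS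
    rw [hPcb] at habs₁
    rw [hPca] at habs₂
    have hGρ : ρc * ρb * (ρc * ρa) * (ρa * ρb) ≤ G ^ 2 := by rw [hG2]; apply le_of_eq; ring
    have key := two_slot_bound (K := K) (L := L) (κ' := κ') (σ := σ) (u₁ := Real.log a) (u₂ := Real.log b)
      (N₁ := (((c * b).primeFactors.card : ℝ)) ^ (c * b).primeFactors.card)
      (N₂ := (((c * a).primeFactors.card : ℝ)) ^ (c * a).primeFactors.card)
      (P₁ := (largestPrimeFactor a : ℝ)) (P₂ := (largestPrimeFactor b : ℝ))
      (Ω₁ := ∏ q ∈ (c * b).primeFactors, Real.log ((max 4 q : ℕ) : ℝ))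
      (Ω₂ := ∏ q ∈ (c * a).primeFactors, Real.log ((max 4 q : ℕ) : ℝ)) (Y := Y₀)
      (R₁ := ρc * ρb) (R₂ := ρc * ρa) (ρ₁ := ρa) (ρ₂ := ρb) (Λ := LG) (G := G) (W := W)
      (n₁ := (c * b).primeFactors.card) (n₂ := (c * a).primeFactors.card) (r := r)
      hK hL hκ' hσ hloga0 hlogb0 (one_le_pow_self _) (one_le_pow_self _) hPa1 hPb1
      (hΩ4_0 _) (hΩ4_0 _) hY₀0 (by positivity) (by positivity) hLG0
      hA hB habs₁ habs₂ hPaρ hPbρ hGρ (pow_self_mul_le_sq hrr hr1 hcardcb hcardca (by rw [hnca, hncb, hrsum]; omega))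
      (by rw [hnca, hncb, hrsum]; omega)
    have hsq : Real.log c ^ 2 ≤ 32 * (Real.log a * Real.log b) := by
      calc Real.log c ^ 2 = Real.log c * Real.log c := sq _
        _ ≤ (8 * Real.log a) * (4 * Real.log b) := mul_le_mul hloga hlogcb hlogc0 (mul_nonneg (by norm_num) hloga0)
        _ = 32 * (Real.log a * Real.log b) := by ring
    refine hfin (A := 32 * K ^ 2) hK32 hL hLM (by positivity)
      (hYsq.trans (le_mul_of_one_le_left hYt0 (by norm_num))) ?_
    calc Real.log c ^ 2 ≤ 32 * (Real.log a * Real.log b) := hsq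
      _ ≤ 32 * (K ^ 2 * (600 * L) ^ (2 * r) * 600 ^ 2 * G ^ 2 * (W ^ 2) ^ (κ' - 1) * LG ^ 6 * Y₀ ^ 2) :=
          mul_le_mul_of_nonneg_left key (by norm_num)
      _ = 32 * K ^ 2 * (600 * L) ^ (2 * r) * 600 ^ 2 * G ^ 2 * (W ^ 2) ^ (κ' - 1) * LG ^ 6 * Y₀ ^ 2 := by
          ring

end KappaDoor

end Literature.NumberTheory.Transcendental.StewartYu

end Part4

/-!
## Part 5 — port of `Summits/ABC/StewartYu/KappaDoorOdd.lean`

# Cell abc-stewartyu, the κ-DOOR, IIIb: the two-slot inequality for an abc triple, `c` odd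

`Summits/ABC/StewartYu/KappaDoorOdd.lean` — cell `abc-stewartyu` (HOME
`run/shared/lean/pub/abc-stewartyu/`, seat p3; HOME/plan/KAPPA-DOOR-RECIPE.md; theorems only).

For an abc triple `a + b = c` (`a ≤ b`, `c ≥ 3`) and a `p`-adic input of shape
`K·Lⁿ·n^{κ'n}·p^σ·…` at every ODD prime (`κ' ≥ 1`, `0 ≤ σ ≤ 2`), exactly one member is even, and
the two odd members carry `p`-adic slots (`KappaDoorSlot.log_le_of_kappaSlot`); when the small member
`a` is one of them and `a² < b`, its slot is replaced by the ARCHIMEDEAN slot on `log c`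
(the tree's `log_le_of_archRoute` with Waldschmidt 1980 PROVED, `waldschmidt1980_hW₂`).  Multiplying
the two slots and absorbing `n^n`, the two top primes and the small logarithms by Chebyshev
(`pow_card_mul_prod_top_mul_prod_log_le`, `card_pow_card_le_rad`) exactly as in (17)–(18) of the
printed line [cite: StewartYu1991, (17)–(18)] gives

  `(log c)² ≤ 512·max(1,K)²·(600 M₀)^{2r}·600²·G²·(W²)^{κ'−1}·(log G)^{2τ₁+9}·(log(6 log c))^{2τ+1}`,

`r = ω(abc)`, `G = rad(abc)`, `W = 600^{r+1} G`, `M₀ = max(L, 2^{71})` (`log_sq_le_of_finBound`).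
The `ε`-endgame is in `KappaDoor.lean`. Everything is [folklore] book-keeping.
-/

section Part5

open _root_.Finset _root_.Real
open Literature.NumberTheory.DiophantineGeometry
open Literature.NumberTheory.DiophantineGeometry.Pasten
open Literature.NumberTheory.Transcendental.Waldschmidt1980 (w80Cw w80Cw_nonneg w80Cw_le waldschmidt1980_hW₂)
open Literature.Barriers.ABC

namespace Literature.NumberTheory.Transcendental.StewartYu

namespace KappaDoor

set_option maxHeartbeats 1600000 in
/-- **The two-slot inequality when `c` is odd** (slots at `c` and at the odd one of `a`, `b`; the archimedean slot replaces `a` when `a² < b`): see `KappaDoor.log_sq_le_of_finBound`. [folklore]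
[cite: StewartYu1991, §3 (source FOLLOWED; the cell’s κ-door, odd case, NOT a printed statement)] -/
theorem log_sq_le_of_finBound_odd {K L κ' σ : ℝ} {τ τ₁ : ℕ} (hK : 0 ≤ K) (hL : 1 ≤ L) (hκ' : 1 ≤ κ')
    (hσ0 : 0 ≤ σ) (hσ : σ ≤ 2) (hP : ∀ p : ℕ, p.Prime → p ≠ 2 → FinBoundAt p K L κ' σ τ τ₁)
    {a b c : ℕ} (h : IsABCTriple a b c) (hab : a ≤ b) (hc3 : 3 ≤ c) (hc_odd : Odd c) :
    Real.log c ^ 2 ≤ 512 * max 1 K ^ 2 * (600 * max L (2 ^ 71)) ^ (2 * (a * b * c).primeFactors.card) *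
      600 ^ 2 * (rad a b c : ℝ) ^ 2 *
      (((600 : ℝ) ^ ((a * b * c).primeFactors.card + 1) * (rad a b c : ℝ)) ^ 2) ^ (κ' - 1) *
      Real.log (rad a b c : ℝ) ^ (2 * τ₁ + 9) * Real.log (6 * Real.log c) ^ (2 * τ + 1) := by
  classical
  obtain ⟨ha, hb, habc, hcop⟩ := id h
  have hc0 : c ≠ 0 := by omega
  have ha0 : a ≠ 0 := ha.ne'
  have hb0 : b ≠ 0 := hb.ne'
  have hb2 : 2 ≤ b := by
    by_contra hlt
    have hb1 : b = 1 := by omega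
    have ha1 : a = 1 := by omega
    omega
  have hneq : a ≠ b := by
    intro heq
    rw [heq] at hcop
    have : b = 1 := by simpa using hcop
    omega
  have hac : a.Coprime c := coprime_left_of_isABCTriple h
  have hbc : b.Coprime c := coprime_right_of_isABCTriple h
  have hac_le : a ≤ c := by omega
  have hbc_le : b ≤ c := by omega
  -- the sets of primes
  set Sa := a.primeFactors with hSa
  set Sb := b.primeFactors with hSb
  set Sc := c.primeFactors with hSc
  set S := (a * b * c).primeFactors with hS
  set r : ℕ := S.card with hr
  have hSab : (a * b).primeFactors = Sa ∪ Sb := Nat.primeFactors_mul ha0 hb0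
  have hSca : (c * a).primeFactors = Sc ∪ Sa := Nat.primeFactors_mul hc0 ha0
  have hScb : (c * b).primeFactors = Sc ∪ Sb := Nat.primeFactors_mul hc0 hb0
  have hSabc : S = Sa ∪ Sb ∪ Sc := by
    rw [hS, Nat.primeFactors_mul (mul_ne_zero ha0 hb0) hc0, hSab]
  have hdab : Disjoint Sa Sb := hcop.disjoint_primeFactors
  have hdac : Disjoint Sa Sc := hac.disjoint_primeFactors
  have hdbc : Disjoint Sb Sc := hbc.disjoint_primeFactors
  have hSaS : Sa ⊆ S := by rw [hSabc]; exact Finset.subset_union_left.trans Finset.subset_union_left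
  have hSbS : Sb ⊆ S := by rw [hSabc]; exact Finset.subset_union_right.trans Finset.subset_union_left
  have hScS : Sc ⊆ S := by rw [hSabc]; exact Finset.subset_union_right
  have hSprime : ∀ q ∈ S, q.Prime := fun q hq => Nat.prime_of_mem_primeFactors hq
  have hSaprime : ∀ q ∈ Sa, q.Prime := fun q hq => Nat.prime_of_mem_primeFactors hq
  have hSbprime : ∀ q ∈ Sb, q.Prime := fun q hq => Nat.prime_of_mem_primeFactors hq
  have hScprime : ∀ q ∈ Sc, q.Prime := fun q hq => Nat.prime_of_mem_primeFactors hq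
  have hrsum : r = Sa.card + Sb.card + Sc.card := by
    rw [hr, hSabc, Finset.card_union_of_disjoint (Finset.disjoint_union_left.mpr ⟨hdac, hdbc⟩),
      Finset.card_union_of_disjoint hdab]
  have hSbne : Sb.Nonempty := Nat.nonempty_primeFactors.mpr (by omega)
  have hScne : Sc.Nonempty := Nat.nonempty_primeFactors.mpr (by omega)
  have hr1 : 1 ≤ r := by rw [hr]; exact Finset.card_pos.mpr (hScne.mono hScS)
  -- the radical and its factors
  set ρa : ℝ := ∏ q ∈ Sa, (q : ℝ) with hρa
  set ρb : ℝ := ∏ q ∈ Sb, (q : ℝ) with hρb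
  set ρc : ℝ := ∏ q ∈ Sc, (q : ℝ) with hρc
  have hρa1 : 1 ≤ ρa := by
    rw [hρa, ← Nat.cast_prod]; exact_mod_cast Finset.prod_pos fun q hq => (hSaprime q hq).pos
  have hρb1 : 1 ≤ ρb := by
    rw [hρb, ← Nat.cast_prod]; exact_mod_cast Finset.prod_pos fun q hq => (hSbprime q hq).pos
  have hρc1 : 1 ≤ ρc := by
    rw [hρc, ← Nat.cast_prod]; exact_mod_cast Finset.prod_pos fun q hq => (hScprime q hq).pos
  set G : ℝ := (rad a b c : ℝ) with hGdef
  have hradS : rad a b c = ∏ q ∈ S, q := by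
    rw [rad_def, Nat.radical_eq_prod_primeFactors]
  have hGprod : G = ∏ q ∈ S, (q : ℝ) := by rw [hGdef, hradS]; push_cast; rfl
  have hGabc : G = ρa * ρb * ρc := by
    rw [hGprod, hSabc, Finset.prod_union (Finset.disjoint_union_left.mpr ⟨hdac, hdbc⟩),
      Finset.prod_union hdab]
  have hG4 : (4 : ℝ) ≤ G := four_le_rad h hab hc3
  have hG1 : (1 : ℝ) ≤ G := by linarith
  have hG0 : (0 : ℝ) < G := by linarith
  have hρa0 : 0 ≤ ρa := by linarith
  have hρb0 : 0 ≤ ρb := by linarith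
  have hρc0 : 0 ≤ ρc := by linarith
  -- products over the generator sets
  have hPab : ∏ q ∈ (a * b).primeFactors, (q : ℝ) = ρa * ρb := by rw [hSab, Finset.prod_union hdab]
  have hPca : ∏ q ∈ (c * a).primeFactors, (q : ℝ) = ρc * ρa := by rw [hSca, Finset.prod_union hdac.symm]
  have hPcb : ∏ q ∈ (c * b).primeFactors, (q : ℝ) = ρc * ρb := by rw [hScb, Finset.prod_union hdbc.symm]
  have hPa_ : ∏ p ∈ a.primeFactors, (p : ℝ) = ρa := rfl
  have hPb_ : ∏ p ∈ b.primeFactors, (p : ℝ) = ρb := rfl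
  have hPc_ : ∏ p ∈ c.primeFactors, (p : ℝ) = ρc := rfl
  -- logarithms
  set LG : ℝ := Real.log G with hLG
  have hLG1 : 1 ≤ LG := by
    rw [hLG, ← Real.log_exp 1]
    apply Real.log_le_log (Real.exp_pos 1)
    have := Real.exp_one_lt_d9; linarith
  have hLG0 : 0 ≤ LG := by linarith
  have hqG : ∀ q ∈ S, (q : ℝ) ≤ G := by
    intro q hq
    have h1 : q ∣ ∏ x ∈ S, x := Finset.dvd_prod_of_mem _ hq
    have h2 : q ≤ rad a b c := by
      rw [hradS]; exact Nat.le_of_dvd (Finset.prod_pos fun x hx => (hSprime x hx).pos) h1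
    rw [hGdef]; exact_mod_cast h2
  have hlog4G : ∀ q ∈ S, Real.log ((max 4 q : ℕ) : ℝ) ≤ LG := by
    intro q hq
    apply Real.log_le_log (by exact_mod_cast lt_of_lt_of_le (by norm_num) (le_max_left 4 q))
    have : ((max 4 q : ℕ) : ℝ) = max (4 : ℝ) (q : ℝ) := by push_cast; rfl
    rw [this]; exact max_le hG4 (hqG q hq)
  set Lc : ℝ := Real.log (6 * Real.log c) with hLc
  have hc3r : (3 : ℝ) ≤ c := by exact_mod_cast hc3
  have hlogc1 : 1 ≤ Real.log c := by
    rw [← Real.log_exp 1]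
    apply Real.log_le_log (Real.exp_pos 1)
    have := Real.exp_one_lt_d9; linarith
  have hlogc0 : 0 ≤ Real.log c := by linarith
  have hB3 : (3 : ℝ) ≤ 6 * Real.log c := by linarith
  have hLc1 : 1 ≤ Lc := by
    rw [hLc, ← Real.log_exp 1]
    apply Real.log_le_log (Real.exp_pos 1)
    have := Real.exp_one_lt_d9; linarith
  have hLc0 : 0 ≤ Lc := by linarith
  -- the slot bundle `Y₀ = Lc^τ LG^{τ₁} LG` and the final bundle
  set Y₀ : ℝ := Lc ^ τ * LG ^ τ₁ * LG with hY₀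
  have hY₀0 : 0 ≤ Y₀ := by positivity
  have hY₀1 : 1 ≤ Y₀ := one_le_mul_of_one_le_of_one_le (one_le_mul_of_one_le_of_one_le
    (one_le_pow₀ hLc1) (one_le_pow₀ hLG1)) hLG1
  set Yt : ℝ := LG ^ (2 * τ₁ + 3) * Lc ^ (2 * τ + 1) with hYt
  have hYsq : Y₀ ^ 2 ≤ Yt := by
    have e : Y₀ ^ 2 = LG ^ (2 * τ₁ + 2) * Lc ^ (2 * τ) := by rw [hY₀]; ring
    rw [e, hYt]
    exact mul_le_mul (pow_le_pow_right₀ hLG1 (by omega)) (pow_le_pow_right₀ hLc1 (by omega))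
      (by positivity) (by positivity)
  have hYarch : (4 * Y₀) * (Lc * LG ^ 2) ≤ 4 * Yt := by
    have e : (4 * Y₀) * (Lc * LG ^ 2) = 4 * (LG ^ (τ₁ + 3) * Lc ^ (τ + 1)) := by rw [hY₀]; ring
    rw [e, hYt]
    refine mul_le_mul_of_nonneg_left ?_ (by norm_num)
    exact mul_le_mul (pow_le_pow_right₀ hLG1 (by omega)) (pow_le_pow_right₀ hLc1 (by omega))
      (by positivity) (by positivity)
  -- constants
  set M₀ : ℝ := max L (2 ^ 71) with hM₀
  have hLM : L ≤ M₀ := le_max_left _ _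
  have hCM : (2 : ℝ) ^ 71 ≤ M₀ := le_max_right _ _
  have hL0 : 0 ≤ L := by linarith
  set W : ℝ := 600 ^ (r + 1) * G with hW
  have hW1 : 1 ≤ W := one_le_mul_of_one_le_of_one_le (one_le_pow₀ (by norm_num)) hG1
  have hrr : ((r : ℝ)) ^ r ≤ W := by rw [hW, hGdef, hr]; exact card_pow_card_le_rad a b c
  -- cardinalities
  have hnab : (a * b).primeFactors.card = Sa.card + Sb.card := by
    rw [hSab, Finset.card_union_of_disjoint hdab]
  have hnca : (c * a).primeFactors.card = Sc.card + Sa.card := by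
    rw [hSca, Finset.card_union_of_disjoint hdac.symm]
  have hncb : (c * b).primeFactors.card = Sc.card + Sb.card := by
    rw [hScb, Finset.card_union_of_disjoint hdbc.symm]
  -- top primes
  have hPa1 : (1 : ℝ) ≤ largestPrimeFactor a := by exact_mod_cast one_le_largestPrimeFactor a
  have hPb1 : (1 : ℝ) ≤ largestPrimeFactor b := by exact_mod_cast one_le_largestPrimeFactor b
  have hPc1 : (1 : ℝ) ≤ largestPrimeFactor c := by exact_mod_cast one_le_largestPrimeFactor c
  have hPle : ∀ {w : ℕ} (Sw : Finset ℕ), Sw = w.primeFactors → (largestPrimeFactor w : ℝ) ≤ ∏ q ∈ Sw, (q : ℝ) := by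
    intro w Sw hSw
    rw [hSw, ← prod_filter_eq_largestPrimeFactor w]
    rw [← Nat.cast_prod, ← Nat.cast_prod]
    exact_mod_cast Finset.prod_le_prod_of_subset_of_one_le' (Finset.filter_subset _ _)
      fun q hq _ => (Nat.prime_of_mem_primeFactors hq).one_lt.le
  have hPaρ : (largestPrimeFactor a : ℝ) ≤ ρa := hPle Sa rfl
  have hPbρ : (largestPrimeFactor b : ℝ) ≤ ρb := hPle Sb rfl
  have hPcρ : (largestPrimeFactor c : ℝ) ≤ ρc := hPle Sc rfl
  have hSabS : (a * b).primeFactors ⊆ S := by rw [hSab]; exact Finset.union_subset hSaS hSbS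
  have hScaS : (c * a).primeFactors ⊆ S := by rw [hSca]; exact Finset.union_subset hScS hSaS
  have hScbS : (c * b).primeFactors ⊆ S := by rw [hScb]; exact Finset.union_subset hScS hSbS
  have hmK : (1 : ℝ) ≤ max 1 K := le_max_left _ _
  have hKm : K ≤ max 1 K := le_max_right _ _
  -- ### the common final shape
  have hWκ : 0 ≤ (W ^ 2) ^ (κ' - 1) := Real.rpow_nonneg (by positivity) _
  have hYt0 : 0 ≤ Yt := by positivity
  have hfin : ∀ {A M Yx : ℝ}, A ≤ 128 * max 1 K ^ 2 → 1 ≤ M → M ≤ M₀ → 0 ≤ Yx → Yx ≤ 4 * Yt →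
      Real.log c ^ 2 ≤ A * (600 * M) ^ (2 * r) * 600 ^ 2 * G ^ 2 * (W ^ 2) ^ (κ' - 1) * LG ^ 6 * Yx →
      Real.log c ^ 2 ≤ 512 * max 1 K ^ 2 * (600 * M₀) ^ (2 * r) * 600 ^ 2 * G ^ 2 *
        (W ^ 2) ^ (κ' - 1) * LG ^ (2 * τ₁ + 9) * Lc ^ (2 * τ + 1) :=
    fun hA hM1 hM hYx0 hYx hmain => final_shape hA hM1 hM hYx0 (by rw [hYt] at hYx; exact hYx) hWκ hmain
  -- sizes used repeatedly
  have hloga0 : 0 ≤ Real.log a := Real.log_nonneg (by exact_mod_cast ha)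
  have hlogb0 : 0 ≤ Real.log b := Real.log_nonneg (by exact_mod_cast hb)
  have hmsq : max 1 K ≤ max 1 K ^ 2 := le_self_pow₀ hmK two_ne_zero
  have hK16 : 16 * K ≤ 128 * max 1 K ^ 2 := by
    calc 16 * K ≤ 16 * max 1 K := mul_le_mul_of_nonneg_left hKm (by norm_num)
      _ ≤ 16 * max 1 K ^ 2 := mul_le_mul_of_nonneg_left hmsq (by norm_num)
      _ ≤ 128 * max 1 K ^ 2 := by
          have : 0 ≤ max 1 K ^ 2 := by positivity
          linarith only [this]
  have hKsq : K ^ 2 ≤ max 1 K ^ 2 := pow_le_pow_left₀ hK hKm 2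
  have hm2 : 0 ≤ max 1 K ^ 2 := by positivity
  have hK32 : 32 * K ^ 2 ≤ 128 * max 1 K ^ 2 := by linarith only [hKsq, hm2]
  have hK8 : 8 * K ^ 2 ≤ 128 * max 1 K ^ 2 := by linarith only [hKsq, hm2]
  have hK4 : 4 * K ^ 2 ≤ 128 * max 1 K ^ 2 := by linarith only [hKsq, hm2]
  have hM₀1 : 1 ≤ M₀ := hL.trans hLM
  have hΩ4_0 : ∀ U : Finset ℕ, 0 ≤ ∏ q ∈ U, Real.log ((max 4 q : ℕ) : ℝ) := fun U =>
    zero_le_one.trans (one_le_prod_log_max_four U)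
  have hcardab : (a * b).primeFactors.card ≤ r := by rw [hnab, hrsum]; omega
  have hcardca : (c * a).primeFactors.card ≤ r := by rw [hnca, hrsum]; omega
  have hcardcb : (c * b).primeFactors.card ≤ r := by rw [hncb, hrsum]; omega
  have hG2 : G ^ 2 = (ρa * ρb * ρc) ^ 2 := by rw [hGabc]
  have hfold : Real.log (6 * Real.log c) ^ τ * Real.log (rad a b c : ℝ) ^ τ₁ * Real.log (rad a b c : ℝ) = Y₀ := by
    rw [hY₀, hLc, hLG]
  have hfold2 : Real.log (6 * Real.log c) * Real.log (rad a b c : ℝ) ^ 2 = Lc * LG ^ 2 := by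
    rw [hLc, hLG]
  have slotC : Odd c → Real.log c ≤ (1 * K) * L ^ (a * b).primeFactors.card *
      ((((a * b).primeFactors.card : ℝ)) ^ (a * b).primeFactors.card) ^ κ' *
      (largestPrimeFactor c : ℝ) ^ σ * (∏ q ∈ (a * b).primeFactors, Real.log ((max 4 q : ℕ) : ℝ)) * Y₀ :=
    fun hodd => by have := slot_c hK hL hσ0 hP h hab hc3 hodd; rwa [hfold] at this
  have hlogcb : Real.log c ≤ 4 * Real.log b := by
    have h2b : (c : ℝ) ≤ 2 * b := by exact_mod_cast (show c ≤ 2 * b by omega)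
    have hb2r : (2 : ℝ) ≤ b := by exact_mod_cast hb2
    have hlog2b : Real.log 2 ≤ Real.log b := Real.log_le_log two_pos hb2r
    calc Real.log c ≤ Real.log (2 * b) := Real.log_le_log (by positivity) h2b
      _ = Real.log 2 + Real.log b := Real.log_mul two_ne_zero (by positivity)
      _ ≤ 4 * Real.log b := by linarith [Real.log_nonneg (by linarith : (1:ℝ) ≤ b)]
  have slotB : Odd b → Real.log b ≤ (1 * K) * L ^ (c * a).primeFactors.card *
      ((((c * a).primeFactors.card : ℝ)) ^ (c * a).primeFactors.card) ^ κ' *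
      (largestPrimeFactor b : ℝ) ^ σ * (∏ q ∈ (c * a).primeFactors, Real.log ((max 4 q : ℕ) : ℝ)) * Y₀ :=
    fun hodd => by have := slot_b hK hL hσ0 hP h hab hc3 hodd; rwa [hfold] at this
  have slotA : Odd a → Real.log a ≤ (1 * K) * L ^ (c * b).primeFactors.card *
      ((((c * b).primeFactors.card : ℝ)) ^ (c * b).primeFactors.card) ^ κ' *
      (largestPrimeFactor a : ℝ) ^ σ * (∏ q ∈ (c * b).primeFactors, Real.log ((max 4 q : ℕ) : ℝ)) * Y₀ :=
    fun hodd => by have := slot_a hK hL hσ0 hP h hab hc3 hodd; rwa [hfold] at this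
  have slotArch : a ^ 2 < b → Real.log c ≤ 16 * (((2 : ℝ) ^ 71) ^ (c * b).primeFactors.card *
      (((c * b).primeFactors.card : ℝ)) ^ (c * b).primeFactors.card *
      (∏ q ∈ (c * b).primeFactors, Real.log ((max 4 q : ℕ) : ℝ)) * (Lc * LG ^ 2)) :=
    fun hcase => by have := slot_arch h hab hc3 hcase; rwa [hfold2] at this
  -- ### parity: exactly one member is even
  have hodd_of : ∀ {x y : ℕ}, x.Coprime y → Even x → Odd y := by
    intro x y hxy hx
    by_contra hy
    rw [Nat.not_odd_iff_even] at hy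
    have h2 : 2 ∣ Nat.gcd x y := Nat.dvd_gcd (even_iff_two_dvd.mp hx) (even_iff_two_dvd.mp hy)
    rw [hxy.gcd_eq_one] at h2
    omega
  -- `c` odd: exactly one of `a`, `b` is even
  have hC := slotC hc_odd
  rw [one_mul] at hC
  rcases Nat.even_or_odd a with ha_even | ha_odd
  · -- `a` even ⇒ `b` odd: two slots `b` and `c`
    have hb_odd : Odd b := hodd_of hcop ha_even
    have hB := slotB hb_odd
    rw [one_mul] at hB
    have habs₁ := absorb_top (T₀ := (c * a).primeFactors) hSprime hlog4G hLG1 c (by rw [hSca]; exact Finset.subset_union_left) hScaS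
    have habs₂ := absorb_top (T₀ := (a * b).primeFactors) hSprime hlog4G hLG1 b (by rw [hSab]; exact Finset.subset_union_right) hSabS
    rw [hPca] at habs₁
    rw [hPab] at habs₂
    have hGρ : ρc * ρa * (ρa * ρb) * (ρb * ρc) ≤ G ^ 2 := by rw [hG2]; apply le_of_eq; ring
    have key := two_slot_bound (K := K) (L := L) (κ' := κ') (σ := σ) (u₁ := Real.log b) (u₂ := Real.log c)
      (N₁ := (((c * a).primeFactors.card : ℝ)) ^ (c * a).primeFactors.card)
      (N₂ := (((a * b).primeFactors.card : ℝ)) ^ (a * b).primeFactors.card)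
      (P₁ := (largestPrimeFactor b : ℝ)) (P₂ := (largestPrimeFactor c : ℝ))
      (Ω₁ := ∏ q ∈ (c * a).primeFactors, Real.log ((max 4 q : ℕ) : ℝ))
      (Ω₂ := ∏ q ∈ (a * b).primeFactors, Real.log ((max 4 q : ℕ) : ℝ)) (Y := Y₀)
      (R₁ := ρc * ρa) (R₂ := ρa * ρb) (ρ₁ := ρb) (ρ₂ := ρc) (Λ := LG) (G := G) (W := W)
      (n₁ := (c * a).primeFactors.card) (n₂ := (a * b).primeFactors.card) (r := r)
      hK hL hκ' hσ hlogb0 hlogc0 (one_le_pow_self _) (one_le_pow_self _) hPb1 hPc1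
      (hΩ4_0 _) (hΩ4_0 _) hY₀0 (by positivity) (by positivity) hLG0
      hB hC habs₁ habs₂ hPbρ hPcρ hGρ (pow_self_mul_le_sq hrr hr1 hcardca hcardab (by rw [hnca, hnab, hrsum]; omega))
      (by rw [hnca, hnab, hrsum]; omega)
    have hsq : Real.log c ^ 2 ≤ 4 * (Real.log b * Real.log c) := by
      calc Real.log c ^ 2 = Real.log c * Real.log c := sq _
        _ ≤ (4 * Real.log b) * Real.log c := mul_le_mul_of_nonneg_right hlogcb hlogc0
        _ = 4 * (Real.log b * Real.log c) := by ring
    refine hfin (A := 4 * K ^ 2) hK4 hL hLM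
      (by positivity) (hYsq.trans (le_mul_of_one_le_left hYt0 (by norm_num))) ?_
    calc Real.log c ^ 2 ≤ 4 * (Real.log b * Real.log c) := hsq
      _ ≤ 4 * (K ^ 2 * (600 * L) ^ (2 * r) * 600 ^ 2 * G ^ 2 * (W ^ 2) ^ (κ' - 1) * LG ^ 6 * Y₀ ^ 2) :=
          mul_le_mul_of_nonneg_left key (by norm_num)
      _ = 4 * K ^ 2 * (600 * L) ^ (2 * r) * 600 ^ 2 * G ^ 2 * (W ^ 2) ^ (κ' - 1) * LG ^ 6 * Y₀ ^ 2 := by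
          ring
  · -- `a` odd ⇒ `b` even
    by_cases hcase : a ^ 2 < b
    · -- slot at `c` × archimedean slot
      have hA := slotArch hcase
      have habs := absorb_none hSprime hlog4G hLG1 hSabS
      have habs' := absorb_top (T₀ := (c * b).primeFactors) hSprime hlog4G hLG1 c (by rw [hScb]; exact Finset.subset_union_left) hScbS
      rw [hPab] at habs
      rw [hPcb] at habs'
      have hGρ : ρa * ρb * (ρc * ρb) * ρc ≤ G ^ 2 := by
        rw [hG2]
        have hsq : ρa ≤ ρa ^ 2 := le_self_pow₀ hρa1 two_ne_zero
        calc ρa * ρb * (ρc * ρb) * ρc = ρa * (ρb ^ 2 * ρc ^ 2) := by ring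
          _ ≤ ρa ^ 2 * (ρb ^ 2 * ρc ^ 2) := mul_le_mul_of_nonneg_right hsq (by positivity)
          _ = (ρa * ρb * ρc) ^ 2 := by ring
      have key := slot_arch_bound (K := K) (L := L) (C := (2 : ℝ) ^ 71) (M₀ := M₀) (κ' := κ') (σ := σ)
        (u := Real.log c) (N := (((a * b).primeFactors.card : ℝ)) ^ (a * b).primeFactors.card)
        (N' := (((c * b).primeFactors.card : ℝ)) ^ (c * b).primeFactors.card)
        (P := (largestPrimeFactor c : ℝ)) (Ω := ∏ q ∈ (a * b).primeFactors, Real.log ((max 4 q : ℕ) : ℝ))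
        (Ω' := ∏ q ∈ (c * b).primeFactors, Real.log ((max 4 q : ℕ) : ℝ)) (Y := Y₀) (Y' := Lc * LG ^ 2)
        (R := ρa * ρb) (R' := ρc * ρb) (ρ := ρc) (Λ := LG) (G := G) (W := W)
        (n := (a * b).primeFactors.card) (n' := (c * b).primeFactors.card) (r := r)
        hK hL (by norm_num) hLM hCM hκ' hσ hlogc0
        (one_le_pow_self _) (pow_nonneg (Nat.cast_nonneg _) _) hPc1 (hΩ4_0 _) (hΩ4_0 _)
        hY₀0 (by positivity) (by positivity) (by positivity) hLG0 hW1
        hC hA habs habs' hPcρ hGρ (pow_self_le_of_le hrr hr1 hcardab) (by rw [hnab, hncb, hrsum]; omega)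
      refine hfin hK16 hM₀1 le_rfl (by positivity) ?_ key
      have h4 : Y₀ * (Lc * LG ^ 2) ≤ (4 * Y₀) * (Lc * LG ^ 2) :=
        mul_le_mul_of_nonneg_right (le_mul_of_one_le_left hY₀0 (by norm_num)) (by positivity)
      exact h4.trans hYarch
    · -- two slots: `a` (`log c ≤ 8 log a`) and `c`
      push Not at hcase
      have hA := slotA ha_odd
      rw [one_mul] at hA
      have hloga : Real.log c ≤ 8 * Real.log a := by
        have h1 : (b : ℝ) ≤ (a : ℝ) ^ 2 := by exact_mod_cast hcase
        have h2 : Real.log b ≤ 2 * Real.log a := by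
          have e : Real.log ((a : ℝ) ^ 2) = 2 * Real.log a := by rw [Real.log_pow]; norm_num
          rw [← e]
          exact Real.log_le_log (by exact_mod_cast hb) h1
        calc Real.log c ≤ 4 * Real.log b := hlogcb
          _ ≤ 4 * (2 * Real.log a) := mul_le_mul_of_nonneg_left h2 (by norm_num)
          _ = 8 * Real.log a := by ring
      have habs₁ := absorb_top (T₀ := (c * b).primeFactors) hSprime hlog4G hLG1 c (by rw [hScb]; exact Finset.subset_union_left) hScbS
      have habs₂ := absorb_top (T₀ := (a * b).primeFactors) hSprime hlog4G hLG1 a (by rw [hSab]; exact Finset.subset_union_left) hSabS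
      rw [hPcb] at habs₁
      rw [hPab] at habs₂
      have hGρ : ρc * ρb * (ρa * ρb) * (ρa * ρc) ≤ G ^ 2 := by rw [hG2]; apply le_of_eq; ring
      have key := two_slot_bound (K := K) (L := L) (κ' := κ') (σ := σ) (u₁ := Real.log a) (u₂ := Real.log c)
        (N₁ := (((c * b).primeFactors.card : ℝ)) ^ (c * b).primeFactors.card)
        (N₂ := (((a * b).primeFactors.card : ℝ)) ^ (a * b).primeFactors.card)
        (P₁ := (largestPrimeFactor a : ℝ)) (P₂ := (largestPrimeFactor c : ℝ))
        (Ω₁ := ∏ q ∈ (c * b).primeFactors, Real.log ((max 4 q : ℕ) : ℝ))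
        (Ω₂ := ∏ q ∈ (a * b).primeFactors, Real.log ((max 4 q : ℕ) : ℝ)) (Y := Y₀)
        (R₁ := ρc * ρb) (R₂ := ρa * ρb) (ρ₁ := ρa) (ρ₂ := ρc) (Λ := LG) (G := G) (W := W)
        (n₁ := (c * b).primeFactors.card) (n₂ := (a * b).primeFactors.card) (r := r)
        hK hL hκ' hσ hloga0 hlogc0 (one_le_pow_self _) (one_le_pow_self _) hPa1 hPc1
        (hΩ4_0 _) (hΩ4_0 _) hY₀0 (by positivity) (by positivity) hLG0
        hA hC habs₁ habs₂ hPaρ hPcρ hGρ (pow_self_mul_le_sq hrr hr1 hcardcb hcardab (by rw [hncb, hnab, hrsum]; omega))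
        (by rw [hncb, hnab, hrsum]; omega)
      have hsq : Real.log c ^ 2 ≤ 8 * (Real.log a * Real.log c) := by
        calc Real.log c ^ 2 = Real.log c * Real.log c := sq _
          _ ≤ (8 * Real.log a) * Real.log c := mul_le_mul_of_nonneg_right hloga hlogc0
          _ = 8 * (Real.log a * Real.log c) := by ring
      refine hfin (A := 8 * K ^ 2) hK8 hL hLM (by positivity)
        (hYsq.trans (le_mul_of_one_le_left hYt0 (by norm_num))) ?_
      calc Real.log c ^ 2 ≤ 8 * (Real.log a * Real.log c) := hsq
        _ ≤ 8 * (K ^ 2 * (600 * L) ^ (2 * r) * 600 ^ 2 * G ^ 2 * (W ^ 2) ^ (κ' - 1) * LG ^ 6 * Y₀ ^ 2) :=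
            mul_le_mul_of_nonneg_left key (by norm_num)
        _ = 8 * K ^ 2 * (600 * L) ^ (2 * r) * 600 ^ 2 * G ^ 2 * (W ^ 2) ^ (κ' - 1) * LG ^ 6 * Y₀ ^ 2 := by
            ring

end KappaDoor

end Literature.NumberTheory.Transcendental.StewartYu

end Part5

/-!
## Part 6 — port of `Summits/ABC/StewartYu/KappaDoor.lean`

# Cell abc-stewartyu, the κ-DOOR, IV: the `ε`-endgame — `log c ≪_ε rad(abc)^{max(1,κ)+ε}` from a
# `p`-adic bound of shape `K·Lⁿ·n^{κn}·p^σ·…` (`σ ≤ 2`) at the ODD primes alone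

`Summits/ABC/StewartYu/KappaDoor.lean` — cell `abc-stewartyu` (HOME
`run/shared/lean/pub/abc-stewartyu/`, seat p3; the planner's `stub_oddKappaDoor` / `OddKappaDoorSpec`
of HOME/plan/Skeleton.lean v2a and HOME/plan/KAPPA-DOOR-RECIPE.md; theorems only).

* `finBoundAt_mono_kappa` — the input with exponent `κ` implies the input with any `κ' ≥ κ`
  (`n^{κn} ≤ n^{κ'n}`), so one may assume `κ' = max(1, κ) ≥ 1`;
* `le_rpow_of_sq_le` — `u ≥ 1`, `u² ≤ C·X·u^δ` (`0 < δ < 2`) ⟹ `u ≤ (C X)^{1/(2−δ)}`;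
* `log_sq_le_of_finBound` — the two-slot inequality (`KappaDoorEven` ∪ `KappaDoorOdd`);
* **`epsShape_of_oddFinBound`** — for `K ≥ 0`, `L ≥ 1`, any real `κ`, `0 ≤ σ ≤ 2` and the input
  `FinBoundAt p K L κ σ τ τ₁` at every odd prime `p`: for every `ε > 0` there are `κ₀, c₀` with
  `log c ≤ κ₀ · rad(abc)^{max(1,κ)+ε}` for all abc triples with `c ≥ c₀` (in fact `c₀ = 3`) — i.e.
  the planner's `OddKappaDoorSpec ⟹ EpsShapeBound (max 1 κ)` (the statement is that `Prop` unfolded).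
  Proof: `KappaDoorMain.log_sq_le_of_finBound` ((17)–(18) of the printed line with two slots), then
  `D^r ≤ A(ε) G^ε` (`exists_pow_le_mul_rpow`, Lemma 4 once more), `(log G)^N ≤ c G^ε`
  (`log_pow_le_mul_rpow`), and the resolution of `u² ≤ C G^{2κ'+ε/2} (log 6u)^N`.

Everything is [folklore] book-keeping; compare the tree's `stewartYu1991_of_yu1990_waldschmidt1980`
(κ = 1, σ = 2, three slots, exponent 2/3) [cite: StewartYu1991, Theorem (p. 226)].
-/

section Part6

open _root_.Finset _root_.Real
open Literature.NumberTheory.DiophantineGeometry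
open Literature.Barriers.ABC

namespace Literature.NumberTheory.Transcendental.StewartYu

namespace KappaDoor

/-- **The square of `log c` from two slots** (both parities): for an abc triple `a + b = c` with
`a ≤ b`, `c ≥ 3`, and the input `FinBoundAt p K L κ' σ τ τ₁` at every odd prime (`κ' ≥ 1`, `0 ≤ σ ≤ 2`):
`(log c)² ≤ 512·max(1,K)²·(600 M₀)^{2r}·600²·G²·(W²)^{κ'−1}·(log G)^{2τ₁+9}·(log(6 log c))^{2τ+1}`.
[folklore] [cite: StewartYu1991, §3 (source FOLLOWED; the cell’s κ-door, NOT a printed statement)] -/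
theorem log_sq_le_of_finBound {K L κ' σ : ℝ} {τ τ₁ : ℕ} (hK : 0 ≤ K) (hL : 1 ≤ L) (hκ' : 1 ≤ κ')
    (hσ0 : 0 ≤ σ) (hσ : σ ≤ 2) (hP : ∀ p : ℕ, p.Prime → p ≠ 2 → FinBoundAt p K L κ' σ τ τ₁)
    {a b c : ℕ} (h : IsABCTriple a b c) (hab : a ≤ b) (hc3 : 3 ≤ c) :
    Real.log c ^ 2 ≤ 512 * max 1 K ^ 2 * (600 * max L (2 ^ 71)) ^ (2 * (a * b * c).primeFactors.card) *
      600 ^ 2 * (rad a b c : ℝ) ^ 2 *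
      (((600 : ℝ) ^ ((a * b * c).primeFactors.card + 1) * (rad a b c : ℝ)) ^ 2) ^ (κ' - 1) *
      Real.log (rad a b c : ℝ) ^ (2 * τ₁ + 9) * Real.log (6 * Real.log c) ^ (2 * τ + 1) := by
  rcases Nat.even_or_odd c with hc | hc
  · exact log_sq_le_of_finBound_even hK hL hκ' hσ0 hσ hP h hab hc3 hc
  · exact log_sq_le_of_finBound_odd hK hL hκ' hσ0 hσ hP h hab hc3 hc

/-- **Monotonicity of the input in `κ`.** [folklore]
[cite: StewartYu1991, §3 (source FOLLOWED; the cell’s κ-door, NOT a printed statement)] -/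
theorem finBoundAt_mono_kappa {p : ℕ} {K L κ κ' σ : ℝ} {τ τ₁ : ℕ} (hK : 0 ≤ K) (hL : 0 ≤ L)
    (hκκ' : κ ≤ κ') (hP : FinBoundAt p K L κ σ τ τ₁) : FinBoundAt p K L κ' σ τ τ₁ := by
  intro n q e hq hinj hqp he hne
  refine (hP n q e hq hinj hqp he hne).trans ?_
  have hn : (n : ℝ) ^ (κ * n) ≤ (n : ℝ) ^ (κ' * n) := by
    rcases Nat.eq_zero_or_pos n with h0 | hpos
    · subst h0; simp
    · exact Real.rpow_le_rpow_of_exponent_le (by exact_mod_cast hpos)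
        (mul_le_mul_of_nonneg_right hκκ' (Nat.cast_nonneg _))
  have hlog : 0 ≤ ∏ i, Real.log ((q i : ℕ) : ℝ) :=
    Finset.prod_nonneg fun i _ => Real.log_nonneg (by exact_mod_cast (hq i).one_lt.le)
  have h1 : 0 ≤ Real.log (max 3 ((Finset.univ.sup fun i => (e i).natAbs : ℕ) : ℝ)) ^ τ :=
    pow_nonneg (Real.log_nonneg ((le_max_left _ _).trans' (by norm_num))) _
  have h2 : 0 ≤ Real.log (max 3 (∏ i, ((q i : ℕ) : ℝ))) ^ τ₁ :=
    pow_nonneg (Real.log_nonneg ((le_max_left _ _).trans' (by norm_num))) _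
  have hp0 : 0 ≤ (p : ℝ) ^ σ := Real.rpow_nonneg (Nat.cast_nonneg _) _
  have h0 : 0 ≤ K * L ^ n := by positivity
  exact mul_le_mul_of_nonneg_right (mul_le_mul_of_nonneg_right (mul_le_mul_of_nonneg_right
    (mul_le_mul_of_nonneg_right (mul_le_mul_of_nonneg_left hn h0) hp0) hlog) h1) h2

/-- **Resolution of `u² ≤ C·X·u^δ`**: for `u ≥ 1`, `δ < 2`:
`u ≤ (C·X)^{1/(2−δ)}`. [folklore]
[cite: StewartYu1991, §3 (source FOLLOWED; the cell’s κ-door, NOT a printed statement)] -/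
theorem le_rpow_of_sq_le {u C X δ : ℝ} (hu : 1 ≤ u) (hδ2 : δ < 2)
    (h : u ^ 2 ≤ C * X * u ^ δ) : u ≤ (C * X) ^ (1 / (2 - δ)) := by
  have hu0 : 0 < u := by linarith
  have hd : 0 < 2 - δ := by linarith
  have h1 : u ^ (2 - δ) ≤ C * X := by
    rw [Real.rpow_sub hu0, show (2 : ℝ) = ((2 : ℕ) : ℝ) by norm_num, Real.rpow_natCast,
      div_le_iff₀ (Real.rpow_pos_of_pos hu0 δ)]
    exact h
  have h2 : u = (u ^ (2 - δ)) ^ (1 / (2 - δ)) := by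
    rw [one_div, Real.rpow_rpow_inv hu0.le hd.ne']
  rw [h2]
  exact Real.rpow_le_rpow (Real.rpow_nonneg hu0.le _) h1 (by positivity)

set_option maxHeartbeats 800000 in
/-- **The κ-door at the odd places** (planner's `OddKappaDoorSpec ⟹ EpsShapeBound (max 1 κ)`):
a `p`-adic bound `ord_p(∏qᵢ^{eᵢ} − 1) ≤ K·Lⁿ·n^{κn}·p^σ·(∏log qᵢ)·(log max(3,max|eᵢ|))^τ·(log max(3,∏qᵢ))^{τ₁}`
at every ODD prime `p` with `0 ≤ σ ≤ 2` gives, for every `ε > 0`, `log c ≤ κ₀(ε)·rad(abc)^{max(1,κ)+ε}`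
for all abc triples with `c ≥ 3`. [folklore]
[cite: StewartYu1991, §3 (source FOLLOWED; the cell’s κ-door, NOT a printed statement)] -/
theorem epsShape_of_oddFinBound {K L κ σ : ℝ} {τ τ₁ : ℕ} (hK : 0 ≤ K) (hL : 1 ≤ L)
    (hσ0 : 0 ≤ σ) (hσ : σ ≤ 2) (hP : ∀ p : ℕ, p.Prime → p ≠ 2 → FinBoundAt p K L κ σ τ τ₁) :
    ∀ ε : ℝ, 0 < ε → ∃ κ₀ c₀ : ℝ, ∀ a b c : ℕ, IsABCTriple a b c → c₀ ≤ (c : ℝ) →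
      Real.log c ≤ κ₀ * (rad a b c : ℝ) ^ (max 1 κ + ε) := by
  intro ε hε
  set κ' : ℝ := max 1 κ with hκ'
  have hκ'1 : 1 ≤ κ' := le_max_left _ _
  have hP' : ∀ p : ℕ, p.Prime → p ≠ 2 → FinBoundAt p K L κ' σ τ τ₁ := fun p hp hp2 =>
    finBoundAt_mono_kappa hK (by linarith) (le_max_right _ _) (hP p hp hp2)
  -- constants
  set ε₁ : ℝ := ε / 4 with hε₁
  have hε₁0 : 0 < ε₁ := by rw [hε₁]; positivity
  set M₀ : ℝ := max L (2 ^ 71) with hM₀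
  have hM₀1 : 1 ≤ M₀ := hL.trans (le_max_left _ _)
  set E : ℝ := (600 : ℝ) ^ (2 * (κ' - 1)) with hE
  have hE1 : 1 ≤ E := Real.one_le_rpow (by norm_num) (by linarith)
  have hE0 : 0 < E := by linarith
  set D : ℝ := (600 * M₀) ^ 2 * E with hD
  have hD1 : 1 ≤ D := one_le_mul_of_one_le_of_one_le (one_le_pow₀ (by linarith)) hE1
  obtain ⟨AD, hAD1, hAD⟩ := exists_pow_le_mul_rpow hD1 (by norm_num : (1 : ℝ) ≤ 600) hε₁0
  set N₁ : ℕ := 2 * τ₁ + 9 with hN₁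
  set N₂ : ℕ := 2 * τ + 1 with hN₂
  set δ : ℝ := ε / (κ' + ε) with hδ
  have hδ0 : 0 < δ := by rw [hδ]; positivity
  have hδ1 : δ < 1 := by rw [hδ, div_lt_one (by positivity)]; linarith
  set C₁ : ℝ := 512 * max 1 K ^ 2 * 600 ^ 2 * E * AD * (((N₁ : ℝ) + 1) / ε₁) ^ N₁ with hC₁
  have hC₁0 : 0 < C₁ := by rw [hC₁]; positivity
  set C₂ : ℝ := C₁ * ((((N₂ : ℝ) + 1) / δ) ^ N₂ * (6 : ℝ) ^ δ) with hC₂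
  have hC₂0 : 0 < C₂ := by rw [hC₂]; positivity
  refine ⟨C₂ ^ (1 / (2 - δ)), 3, ?_⟩
  -- WLOG `a ≤ b`
  suffices hmain : ∀ a b c : ℕ, IsABCTriple a b c → a ≤ b → (3 : ℝ) ≤ c →
      Real.log c ≤ C₂ ^ (1 / (2 - δ)) * (rad a b c : ℝ) ^ (κ' + ε) by
    intro a b c h hc
    rcases le_total a b with hab | hba
    · exact hmain a b c h hab hc
    · obtain ⟨ha, hb, habc, hcop⟩ := h
      have h' : IsABCTriple b a c := ⟨hb, ha, by omega, hcop.symm⟩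
      have hrad : rad b a c = rad a b c := by rw [rad_def, rad_def, mul_comm b a]
      have := hmain b a c h' hba hc
      rwa [hrad] at this
  intro a b c h hab hc3r
  have hc3 : 3 ≤ c := by exact_mod_cast hc3r
  have hsq := log_sq_le_of_finBound hK hL hκ'1 hσ0 hσ hP' h hab hc3
  -- notation
  set r : ℕ := (a * b * c).primeFactors.card with hr
  set G : ℝ := (rad a b c : ℝ) with hGdef
  have hG1 : 1 ≤ G := one_le_rad_real a b c
  have hG0 : 0 < G := by linarith
  set u : ℝ := Real.log c with hudef
  have hu1 : 1 ≤ u := by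
    rw [hudef, ← Real.log_exp 1]
    apply Real.log_le_log (Real.exp_pos 1)
    have := Real.exp_one_lt_d9; linarith
  have hu0 : 0 < u := by linarith
  -- `D^r ≤ AD · G^{ε₁}`
  have hrr : ((r : ℝ)) ^ r ≤ 600 ^ (r + 1) * G := by rw [hr, hGdef]; exact card_pow_card_le_rad a b c
  have hDr := hAD r G hG1 hrr
  -- `(log G)^{N₁} ≤ c · G^{ε₁}`
  have hLG := log_pow_le_mul_rpow hε₁0 N₁ hG1
  -- `(log (6u))^{N₂} ≤ c · (6u)^δ`
  have h6u : (1 : ℝ) ≤ 6 * u := by linarith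
  have hLc := log_pow_le_mul_rpow hδ0 N₂ h6u
  -- the factor `((600^{r+1} G)²)^{κ'−1} = E^{r+1} · (G²)^{κ'−1}`
  have h600 : (0 : ℝ) ≤ 600 := by norm_num
  have hEpow : (((600 : ℝ) ^ (r + 1)) ^ 2) ^ (κ' - 1) = E ^ (r + 1) := by
    rw [hE, ← pow_mul, ← Real.rpow_natCast (600 : ℝ) ((r + 1) * 2), ← Real.rpow_mul h600,
      ← Real.rpow_natCast ((600 : ℝ) ^ (2 * (κ' - 1))) (r + 1), ← Real.rpow_mul h600]
    congr 1; push_cast; ring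
  have hW2 : (((600 : ℝ) ^ (r + 1) * G) ^ 2) ^ (κ' - 1) = E ^ (r + 1) * (G ^ 2) ^ (κ' - 1) := by
    rw [mul_pow, Real.mul_rpow (by positivity) (by positivity), hEpow]
  have hG2κ : G ^ 2 * (G ^ 2) ^ (κ' - 1) = G ^ (2 * κ') := by
    rw [show G ^ 2 = G ^ (2 : ℝ) by rw [show (2 : ℝ) = ((2 : ℕ) : ℝ) by norm_num, Real.rpow_natCast],
      ← Real.rpow_mul hG0.le, ← Real.rpow_add hG0]
    congr 1; ring
  -- assemble: `u² ≤ C₁ · G^{2κ'+2ε₁} · (log 6u)^{N₂}`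
  have hstep : u ^ 2 ≤ C₁ * G ^ (2 * κ' + 2 * ε₁) * Real.log (6 * u) ^ N₂ := by
    have hsq' := hsq
    rw [hW2] at hsq'
    have e1 : 512 * max 1 K ^ 2 * (600 * M₀) ^ (2 * r) * 600 ^ 2 * G ^ 2 *
        (E ^ (r + 1) * (G ^ 2) ^ (κ' - 1)) * Real.log G ^ N₁ * Real.log (6 * u) ^ N₂ =
        (512 * max 1 K ^ 2 * 600 ^ 2 * E) * (D ^ r * (G ^ 2 * (G ^ 2) ^ (κ' - 1))) * Real.log G ^ N₁ *
          Real.log (6 * u) ^ N₂ := by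
      rw [hD, mul_pow ((600 * M₀) ^ 2) E r, ← pow_mul, pow_succ]; ring
    rw [e1, hG2κ] at hsq'
    refine hsq'.trans ?_
    have hlog0 : 0 ≤ Real.log (6 * u) ^ N₂ := pow_nonneg (Real.log_nonneg h6u) _
    have e2 : C₁ * G ^ (2 * κ' + 2 * ε₁) * Real.log (6 * u) ^ N₂ =
        (512 * max 1 K ^ 2 * 600 ^ 2 * E) * ((AD * G ^ ε₁) * G ^ (2 * κ')) *
          ((((N₁ : ℝ) + 1) / ε₁) ^ N₁ * G ^ ε₁) * Real.log (6 * u) ^ N₂ := by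
      rw [hC₁, show 2 * κ' + 2 * ε₁ = ε₁ + 2 * κ' + ε₁ by ring, Real.rpow_add hG0, Real.rpow_add hG0]
      ring
    rw [e2]
    have h0 : 0 ≤ 512 * max 1 K ^ 2 * 600 ^ 2 * E := by positivity
    refine mul_le_mul_of_nonneg_right ?_ hlog0
    refine mul_le_mul ?_ hLG (pow_nonneg (Real.log_nonneg hG1) _) (by positivity)
    exact mul_le_mul_of_nonneg_left (mul_le_mul_of_nonneg_right hDr (by positivity)) h0
  -- `u² ≤ C₂ · G^{θ} · u^δ`
  have hstep2 : u ^ 2 ≤ C₂ * G ^ (2 * κ' + 2 * ε₁) * u ^ δ := by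
    refine hstep.trans ?_
    have h6 : (6 * u) ^ δ = (6 : ℝ) ^ δ * u ^ δ := Real.mul_rpow (by norm_num) hu0.le
    calc C₁ * G ^ (2 * κ' + 2 * ε₁) * Real.log (6 * u) ^ N₂
        ≤ C₁ * G ^ (2 * κ' + 2 * ε₁) * ((((N₂ : ℝ) + 1) / δ) ^ N₂ * (6 * u) ^ δ) :=
          mul_le_mul_of_nonneg_left hLc (by positivity)
      _ = C₂ * G ^ (2 * κ' + 2 * ε₁) * u ^ δ := by rw [h6, hC₂]; ring
  -- resolve
  have hres := le_rpow_of_sq_le hu1 (by linarith) hstep2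
  refine hres.trans ?_
  rw [Real.mul_rpow hC₂0.le (Real.rpow_nonneg hG0.le _), ← Real.rpow_mul hG0.le]
  refine mul_le_mul_of_nonneg_left ?_ (Real.rpow_nonneg hC₂0.le _)
  refine Real.rpow_le_rpow_of_exponent_le hG1 ?_
  -- `(2κ' + ε/2)/(2 − δ) ≤ κ' + ε` with `δ = ε/(κ'+ε)`
  have hd : 0 < 2 - δ := by linarith
  rw [mul_one_div, div_le_iff₀ hd, hε₁, hδ]
  have hk : 0 < κ' + ε := by positivity
  have e : (κ' + ε) * (2 - ε / (κ' + ε)) = 2 * κ' + ε := by field_simp; ring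
  rw [e]; linarith

end KappaDoor

end Literature.NumberTheory.Transcendental.StewartYu

end Part6

/-!
## Part 7 — port of `Summits/ABC/StewartYu/KappaDoorEpsShape.lean`

# Cell abc-stewartyu, the κ-door onto the tree's named `ε`-shape, and the M1⁺ composition

`Summits/ABC/StewartYu/KappaDoorEpsShape.lean` — cell `abc-stewartyu` (HOME
`run/shared/lean/pub/abc-stewartyu/`, seat p3; theorems only, no named fact).  With
`Literature.Barriers.ABC.EpsShapeBound` now a tree definition (`BakerMethodBoundsEpsShape.lean`),
the κ-door `KappaDoor.epsShape_of_oddFinBound` concludes it BY NAME: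

* `KappaDoor.epsShapeBound_of_oddFinBound` — the one-prime bound `FinBoundAt p K L κ σ τ τ₁` at every
  odd prime (`K ≥ 0`, `L ≥ 1`, `0 ≤ σ ≤ 2`, any real `κ`) gives `EpsShapeBound (max 1 κ)`;
* `KappaDoor.epsShapeBound_of_principal_core` — WP-M (principal generators) and ANY Theorem-A-shaped
  bound with envelope `C(m) ≤ c₁^m m^{c₂ m}` give `EpsShapeBound (max 1 (c₂ + 2))` (the glue
  `primePadicBoundAt_odd_of_principal`: `K = 4704`, `L = 32c₁`, `κ = c₂ + 2`, `σ = τ = τ₁ = 2`);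
* `KappaDoor.epsShapeBoundFour_of_principal_core` — with `c₂ ≤ 2` this is the rung
  `EpsShapeBoundFour` (`log c ≪_ε rad^{4+ε}`), and `KappaDoor.epsShapeBoundThree_of_principal_core` —
  with `c₂ ≤ 1` the rung `EpsShapeBoundThree`.

Everything is [folklore].
-/

section Part7

open _root_.Finset
open Literature.NumberTheory.DiophantineGeometry
open Literature.Barriers.ABC

namespace Literature.NumberTheory.Transcendental.StewartYu

namespace KappaDoor

/-- **The κ-door onto the named `ε`-shape**: the one-prime bound at every odd prime with exponent `κ`
on `n^{κn}` and `p^σ`, `σ ≤ 2`, gives `log c ≪_ε rad(abc)^{max(1,κ)+ε}`. [folklore]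
[cite: StewartYu1991, §3 (source FOLLOWED; the cell’s composition onto the named ε-shape, NOT a printed statement)] -/
theorem epsShapeBound_of_oddFinBound {K L κ σ : ℝ} {τ τ₁ : ℕ} (hK : 0 ≤ K) (hL : 1 ≤ L)
    (hσ0 : 0 ≤ σ) (hσ : σ ≤ 2) (hP : ∀ p : ℕ, p.Prime → p ≠ 2 → FinBoundAt p K L κ σ τ τ₁) :
    EpsShapeBound (max 1 κ) :=
  fun ε hε => epsShape_of_oddFinBound hK hL hσ0 hσ hP ε hε

/-- **M1⁺ composition**: WP-M and a Theorem-A-shaped bound with envelope `C(m) ≤ c₁^m m^{c₂ m}` give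
`EpsShapeBound (max 1 (c₂ + 2))`. [folklore]
[cite: StewartYu1991, §3 (source FOLLOWED; the cell’s composition onto the named ε-shape, NOT a printed statement)] -/
theorem epsShapeBound_of_principal_core
    (hM : ∀ (p : ℕ), p.Prime → p ≠ 2 → ∀ (m : ℕ) (q : Fin m → ℕ),
      (∀ i, (q i).Prime) → Function.Injective q → (∀ i, q i ≠ p) →
      ∀ (e : Fin m → ℤ), e ≠ 0 → 1 ≤ padicValRat p (∏ i, (q i : ℚ) ^ e i - 1) →
      ∃ (α : Fin m → ℚ) (e' : Fin m → ℤ),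
        (∀ j, α j ≠ 0 ∧ 1 ≤ padicValRat p (α j - 1)) ∧
        (∀ μ : Fin m → ℤ, ∏ j, α j ^ μ j = 1 → μ = 0) ∧
        (∀ T : Finset (Fin m), T.Nonempty → ¬ IsSquare (∏ j ∈ T, α j)) ∧
        e' ≠ 0 ∧ ∏ i, (q i : ℚ) ^ e i = ∏ j, α j ^ e' j ∧
        (∏ j, Height.logHeight₁ (α j)) ≤ (m : ℝ) ^ (2 * m) * p * ∏ i, Real.log (q i) ∧
        (∀ j, (|e' j| : ℝ) ≤
          (m : ℝ) ^ (2 * m) * p * (∏ i, Real.log (q i)) * (Finset.univ.sup fun i => (e i).natAbs)) ∧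
        (∀ j, Real.log p ≤ 2 * Height.logHeight₁ (α j)))
    {C : ℕ → ℝ} {r : ℕ → ℕ} {c₁ c₂ : ℝ} (hc₁ : 1 ≤ c₁)
    (hC : ∀ m, 0 ≤ C m ∧ C m ≤ c₁ ^ m * (m : ℝ) ^ (c₂ * m))
    (hA : ∀ (p : ℕ), p.Prime → p ≠ 2 →
      ∀ (m : ℕ) (α : Fin m → ℚ) (b : Fin m → ℤ) (V : Fin m → ℝ) (Vmax W : ℝ),
        (∀ j, α j ≠ 0 ∧ 1 ≤ padicValRat p (α j - 1)) →
        (∀ μ : Fin m → ℤ, ∏ j, α j ^ μ j = 1 → μ = 0) →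
        (∀ T : Finset (Fin m), T.Nonempty → ¬ IsSquare (∏ j ∈ T, α j)) →
        (∀ j, Height.logHeight₁ (α j) ≤ V j) → (∀ j, Real.log p ≤ V j) → (∀ j, V j ≤ Vmax) →
        b ≠ 0 → (∀ j, Real.log (max 3 (|b j| : ℝ)) ≤ W) →
        (padicValRat p (∏ j, α j ^ b j - 1) : ℝ) * Real.log p ≤
          C m * (∏ j, V j) * (W + Real.log (2 * Vmax)) * Real.log (2 * Vmax) / Real.log p ^ r m) :
    EpsShapeBound (max 1 (c₂ + 2)) := by
  refine epsShapeBound_of_oddFinBound (K := 4704) (L := 32 * c₁) (σ := 2) (τ := 2) (τ₁ := 2)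
    (by norm_num) (by linarith) (by norm_num) le_rfl ?_
  intro p hp hp2 n q e hq hinj hqp he hne1
  exact primePadicBoundAt_odd_of_principal hM hc₁ hC hA hp hp2 n q e hq hinj hqp he hne1

/-- **The rung `rad^{4+ε}`** from WP-M and a Theorem-A-shaped bound with `c₂ ≤ 2`. [folklore]
[cite: StewartYu1991, §3 (source FOLLOWED; the cell’s composition onto the named ε-shape, NOT a printed statement)] -/
theorem epsShapeBoundFour_of_principal_core
    (hM : ∀ (p : ℕ), p.Prime → p ≠ 2 → ∀ (m : ℕ) (q : Fin m → ℕ),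
      (∀ i, (q i).Prime) → Function.Injective q → (∀ i, q i ≠ p) →
      ∀ (e : Fin m → ℤ), e ≠ 0 → 1 ≤ padicValRat p (∏ i, (q i : ℚ) ^ e i - 1) →
      ∃ (α : Fin m → ℚ) (e' : Fin m → ℤ),
        (∀ j, α j ≠ 0 ∧ 1 ≤ padicValRat p (α j - 1)) ∧
        (∀ μ : Fin m → ℤ, ∏ j, α j ^ μ j = 1 → μ = 0) ∧
        (∀ T : Finset (Fin m), T.Nonempty → ¬ IsSquare (∏ j ∈ T, α j)) ∧
        e' ≠ 0 ∧ ∏ i, (q i : ℚ) ^ e i = ∏ j, α j ^ e' j ∧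
        (∏ j, Height.logHeight₁ (α j)) ≤ (m : ℝ) ^ (2 * m) * p * ∏ i, Real.log (q i) ∧
        (∀ j, (|e' j| : ℝ) ≤
          (m : ℝ) ^ (2 * m) * p * (∏ i, Real.log (q i)) * (Finset.univ.sup fun i => (e i).natAbs)) ∧
        (∀ j, Real.log p ≤ 2 * Height.logHeight₁ (α j)))
    {C : ℕ → ℝ} {r : ℕ → ℕ} {c₁ c₂ : ℝ} (hc₁ : 1 ≤ c₁) (hc₂ : c₂ ≤ 2)
    (hC : ∀ m, 0 ≤ C m ∧ C m ≤ c₁ ^ m * (m : ℝ) ^ (c₂ * m))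
    (hA : ∀ (p : ℕ), p.Prime → p ≠ 2 →
      ∀ (m : ℕ) (α : Fin m → ℚ) (b : Fin m → ℤ) (V : Fin m → ℝ) (Vmax W : ℝ),
        (∀ j, α j ≠ 0 ∧ 1 ≤ padicValRat p (α j - 1)) →
        (∀ μ : Fin m → ℤ, ∏ j, α j ^ μ j = 1 → μ = 0) →
        (∀ T : Finset (Fin m), T.Nonempty → ¬ IsSquare (∏ j ∈ T, α j)) →
        (∀ j, Height.logHeight₁ (α j) ≤ V j) → (∀ j, Real.log p ≤ V j) → (∀ j, V j ≤ Vmax) →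
        b ≠ 0 → (∀ j, Real.log (max 3 (|b j| : ℝ)) ≤ W) →
        (padicValRat p (∏ j, α j ^ b j - 1) : ℝ) * Real.log p ≤
          C m * (∏ j, V j) * (W + Real.log (2 * Vmax)) * Real.log (2 * Vmax) / Real.log p ^ r m) :
    EpsShapeBoundFour := by
  rw [epsShapeBoundFour_iff]
  refine epsShapeBound_mono ?_ (epsShapeBound_of_principal_core hM hc₁ hC hA)
  exact max_le (by norm_num) (by linarith)

/-- **The rung `rad^{3+ε}`** from WP-M and a Theorem-A-shaped bound with `c₂ ≤ 1`. [folklore]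
[cite: StewartYu1991, §3 (source FOLLOWED; the cell’s composition onto the named ε-shape, NOT a printed statement)] -/
theorem epsShapeBoundThree_of_principal_core
    (hM : ∀ (p : ℕ), p.Prime → p ≠ 2 → ∀ (m : ℕ) (q : Fin m → ℕ),
      (∀ i, (q i).Prime) → Function.Injective q → (∀ i, q i ≠ p) →
      ∀ (e : Fin m → ℤ), e ≠ 0 → 1 ≤ padicValRat p (∏ i, (q i : ℚ) ^ e i - 1) →
      ∃ (α : Fin m → ℚ) (e' : Fin m → ℤ),
        (∀ j, α j ≠ 0 ∧ 1 ≤ padicValRat p (α j - 1)) ∧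
        (∀ μ : Fin m → ℤ, ∏ j, α j ^ μ j = 1 → μ = 0) ∧
        (∀ T : Finset (Fin m), T.Nonempty → ¬ IsSquare (∏ j ∈ T, α j)) ∧
        e' ≠ 0 ∧ ∏ i, (q i : ℚ) ^ e i = ∏ j, α j ^ e' j ∧
        (∏ j, Height.logHeight₁ (α j)) ≤ (m : ℝ) ^ (2 * m) * p * ∏ i, Real.log (q i) ∧
        (∀ j, (|e' j| : ℝ) ≤
          (m : ℝ) ^ (2 * m) * p * (∏ i, Real.log (q i)) * (Finset.univ.sup fun i => (e i).natAbs)) ∧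
        (∀ j, Real.log p ≤ 2 * Height.logHeight₁ (α j)))
    {C : ℕ → ℝ} {r : ℕ → ℕ} {c₁ c₂ : ℝ} (hc₁ : 1 ≤ c₁) (hc₂ : c₂ ≤ 1)
    (hC : ∀ m, 0 ≤ C m ∧ C m ≤ c₁ ^ m * (m : ℝ) ^ (c₂ * m))
    (hA : ∀ (p : ℕ), p.Prime → p ≠ 2 →
      ∀ (m : ℕ) (α : Fin m → ℚ) (b : Fin m → ℤ) (V : Fin m → ℝ) (Vmax W : ℝ),
        (∀ j, α j ≠ 0 ∧ 1 ≤ padicValRat p (α j - 1)) →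
        (∀ μ : Fin m → ℤ, ∏ j, α j ^ μ j = 1 → μ = 0) →
        (∀ T : Finset (Fin m), T.Nonempty → ¬ IsSquare (∏ j ∈ T, α j)) →
        (∀ j, Height.logHeight₁ (α j) ≤ V j) → (∀ j, Real.log p ≤ V j) → (∀ j, V j ≤ Vmax) →
        b ≠ 0 → (∀ j, Real.log (max 3 (|b j| : ℝ)) ≤ W) →
        (padicValRat p (∏ j, α j ^ b j - 1) : ℝ) * Real.log p ≤
          C m * (∏ j, V j) * (W + Real.log (2 * Vmax)) * Real.log (2 * Vmax) / Real.log p ^ r m) :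
    EpsShapeBoundThree := by
  rw [epsShapeBoundThree_iff]
  refine epsShapeBound_mono ?_ (epsShapeBound_of_principal_core hM hc₁ hC hA)
  exact max_le (by norm_num) (by linarith)

end KappaDoor

end Literature.NumberTheory.Transcendental.StewartYu

end Part7

/-!
## Part 8 — port of `Summits/ABC/StewartYu/PadicCW77EpsShapeFiveHalves.lean`

# Cell abc-stewartyu: `log c ≪_ε rad(abc)^{5/2+ε}` — the rung between `rad^{3+ε}` (M1⁺(3)) and
# `rad^{2+ε}` (M1⁺(2), open), from Theorem A₁ and the sharp principal reduction WP-M♭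

`Summits/ABC/StewartYu/PadicCW77EpsShapeFiveHalves.lean` — cell `abc-stewartyu` (seat p1; theorems
only, no definition, no named fact). Composition:

* Theorem A with `c₂ = 1` (`theoremAShapeLe_one_holds`, tree: `c₁ = 2⁷⁰`, `r = 0`;
  `Summits/ABC/ABC/Theorems/PadicPrincipalCoreST86TheoremA.lean`);
* WP-M♭ (`PrincipalLattice.exists_principal_generators_sharp`): Kummer-free principal generators
  with `∏ h(αⱼ) ≤ m^m √(m!) · p · ∏ log qᵢ` — Minkowski II in the weighted EUCLIDEAN norm, the
  Euclidean Mahler basis (nearest-plane reduction), Cauchy–Schwarz — instead of WP-M's `m^{2m}`;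
* the envelope `m^m √(m!) ≤ m^{3m/2}` (`pow_mul_sqrt_factorial_le_rpow`);
* the general glue (`primePadicBoundAt_odd_of_principal_general`, `c₄ = 3/2`): the one-prime bound
  at every odd prime with `κ = c₂ + 3/2 = 5/2`, `σ = 2`;
* the κ-door at the odd places (`KappaDoor.epsShapeBound_of_oddFinBound`, Stewart–Yu 1991 §3 with
  `n^{κn}`): `EpsShapeBound (max 1 κ)`, and `epsShapeBound_mono`.

Result: `epsShapeBound_five_halves : Literature.Barriers.ABC.EpsShapeBound (5/2)`, i.e. for every
`ε > 0` there are `κ, c₀` with `log c ≤ κ · rad(abc)^{5/2+ε}` for all abc-triples with `c ≥ c₀`.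
WHAT THIS IS NOT: not `EpsShapeBound 2` (route B₂'s WPMSharp, loss `C^m`, is open); not a route item
(the rung leaf `EpsShapeBound (5/2)` is not registered); exponential in `rad`, inside the Baker class
(`Literature.Barriers.ABC.BakerMethodBounds`), far from Stewart–Yu 1991's `rad^{2/3+ε}`.
Everything is [folklore] assembly of results PROVED in the tree.
-/

section Part8

open _root_.Finset
open Literature.Barriers.ABC

namespace Literature.NumberTheory.Transcendental.StewartYu

/-- The envelope of WP-M♭: `m^m · √(m!) ≤ m^{3m/2}` (`m! ≤ m^m`). [folklore]
[cite: StewartYu1991, §3 with Waldschmidt1980, Prop. 3.8 (sources FOLLOWED; the rung rad^{5/2+ε} is the cell’s kernel composition, NOT a printed statement)] -/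
theorem pow_mul_sqrt_factorial_le_rpow (m : ℕ) :
    (m : ℝ) ^ m * Real.sqrt (m.factorial) ≤ (m : ℝ) ^ ((3 / 2 : ℝ) * m) := by
  rcases Nat.eq_zero_or_pos m with hm | hm
  · subst hm; simp
  have hm0 : (0 : ℝ) < m := by exact_mod_cast hm
  have h1 : Real.sqrt (m.factorial : ℝ) ≤ (m : ℝ) ^ ((m : ℝ) / 2) := by
    calc Real.sqrt (m.factorial : ℝ) ≤ Real.sqrt ((m : ℝ) ^ m) := by
          apply Real.sqrt_le_sqrt; exact_mod_cast Nat.factorial_le_pow m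
      _ = (m : ℝ) ^ ((m : ℝ) / 2) := by
          rw [Real.sqrt_eq_rpow, ← Real.rpow_natCast, ← Real.rpow_mul hm0.le]
          congr 1; ring
  calc (m : ℝ) ^ m * Real.sqrt (m.factorial) ≤ (m : ℝ) ^ m * (m : ℝ) ^ ((m : ℝ) / 2) :=
        mul_le_mul_of_nonneg_left h1 (by positivity)
    _ = (m : ℝ) ^ ((3 / 2 : ℝ) * m) := by
        rw [← Real.rpow_natCast (m : ℝ) m, ← Real.rpow_add hm0]
        congr 1; ring

/-- **The rung `rad^{5/2+ε}` from any Theorem-A-shaped bound with envelope exponent `c₂ ≤ 1`**: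
WP-M♭ (heights `≤ m^m √(m!) p ∏ log qᵢ ≤ m^{3m/2} p ∏ log qᵢ`), the general glue with `c₄ = 3/2`
(`κ = c₂ + 3/2`, `σ = 2`), the κ-door at the odd places, and monotonicity
`max 1 (c₂ + 3/2) ≤ 5/2`. [folklore]
[cite: StewartYu1991, §3 with Waldschmidt1980, Prop. 3.8 (sources FOLLOWED; the rung rad^{5/2+ε} is the cell’s kernel composition, NOT a printed statement)] -/
theorem epsShapeBound_five_halves_of_principal_core
    {C : ℕ → ℝ} {r : ℕ → ℕ} {c₁ c₂ : ℝ} (hc₁ : 1 ≤ c₁) (hc₂ : c₂ ≤ 1)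
    (hC : ∀ m, 0 ≤ C m ∧ C m ≤ c₁ ^ m * (m : ℝ) ^ (c₂ * m))
    (hA : ∀ (p : ℕ), p.Prime → p ≠ 2 →
      ∀ (m : ℕ) (α : Fin m → ℚ) (b : Fin m → ℤ) (V : Fin m → ℝ) (Vmax W : ℝ),
        (∀ j, α j ≠ 0 ∧ 1 ≤ padicValRat p (α j - 1)) →
        (∀ μ : Fin m → ℤ, ∏ j, α j ^ μ j = 1 → μ = 0) →
        (∀ T : Finset (Fin m), T.Nonempty → ¬ IsSquare (∏ j ∈ T, α j)) →
        (∀ j, Height.logHeight₁ (α j) ≤ V j) → (∀ j, Real.log p ≤ V j) → (∀ j, V j ≤ Vmax) →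
        b ≠ 0 → (∀ j, Real.log (max 3 (|b j| : ℝ)) ≤ W) →
        (padicValRat p (∏ j, α j ^ b j - 1) : ℝ) * Real.log p ≤
          C m * (∏ j, V j) * (W + Real.log (2 * Vmax)) * Real.log (2 * Vmax) / Real.log p ^ r m) :
    EpsShapeBound (5 / 2) := by
  have h : EpsShapeBound (max 1 (c₂ + 3 / 2)) := by
    refine KappaDoor.epsShapeBound_of_oddFinBound (K := 4704) (L := 32 * c₁) (σ := 2) (τ := 2)
      (τ₁ := 2) (by norm_num) (by linarith) (by norm_num) le_rfl ?_
    intro p hp hp2 n q e hq hinj hqp he hne1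
    exact primePadicBoundAt_odd_of_principal_general
      (A := fun m => (m : ℝ) ^ m * Real.sqrt (m.factorial)) (c₄ := 3 / 2) (by norm_num)
      pow_mul_sqrt_factorial_le_rpow PrincipalLattice.exists_principal_generators_sharp hc₁ hC hA
      hp hp2 n q e hq hinj hqp he hne1
  refine epsShapeBound_mono ?_ h
  exact max_le (by norm_num) (by linarith)

/-- **`log c ≪_ε rad(abc)^{5/2+ε}`**: for every `ε > 0` there are `κ, c₀` such that every abc-triple
with `c ≥ c₀` has `log c ≤ κ · rad(abc)^{5/2+ε}` — from Theorem A₁ (`theoremAShapeLe_one_holds`,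
`c₁ = 2⁷⁰`, `c₂ = 1`) through `epsShapeBound_five_halves_of_principal_core`. The cell's previous
kernel rungs were `rad^15` (M1) and `rad^{3+ε}` (M1⁺(3)). [folklore]
[cite: StewartYu1991, §3 with Waldschmidt1980, Prop. 3.8 (sources FOLLOWED; the rung rad^{5/2+ε} is the cell’s kernel composition, NOT a printed statement)] -/
theorem epsShapeBound_five_halves : EpsShapeBound (5 / 2) := by
  obtain ⟨C, r, c₁, c₂, hc₁, _hc₂, hc₂1, hC, hA⟩ := theoremAShapeLe_one_holds
  exact epsShapeBound_five_halves_of_principal_core hc₁ hc₂1 hC hA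

/-- **The rung leaf `EpsShapeBoundFiveHalves` HOLDS** (by-name discharge of the named statement
`Literature.Barriers.ABC.EpsShapeBoundFiveHalves := EpsShapeBound (5/2)`, rung A1.M1⁺(5/2)):
`log c ≪_ε rad(abc)^{5/2+ε}`. [folklore]
[cite: StewartYu1991, §3 with Waldschmidt1980, Prop. 3.8 (sources FOLLOWED; the rung rad^{5/2+ε} is the cell’s kernel composition, NOT a printed statement)] -/
theorem epsShapeBoundFiveHalves_holds : Literature.Barriers.ABC.EpsShapeBoundFiveHalves :=
  epsShapeBound_five_halves

/-- **`GlueSpecFlat` of the staged rung route `PadicPrincipalCoreRadFiveHalves` HOLDS** (its text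
verbatim): WP-M♭ ∧ any Theorem-A-shaped bound with envelope `c₁^m m^{c₂ m}` ⇒ the odd one-prime bound
with `(K, L, κ) = (4704, 32c₁, c₂ + 3/2)`, `σ = τ = τ₁ = 2` — the instance `A(m) = m^m √(m!)`,
`c₄ = 3/2` of `primePadicBoundAt_odd_of_principal_general`. [folklore]
[cite: StewartYu1991, §3 with Waldschmidt1980, Prop. 3.8 (sources FOLLOWED; the rung rad^{5/2+ε} is the cell’s kernel composition, NOT a printed statement)] -/
theorem glueSpecFlat_holds :
    (∀ (p : ℕ), p.Prime → p ≠ 2 → ∀ (m : ℕ) (q : Fin m → ℕ), (∀ i, (q i).Prime) → Function.Injective q → (∀ i, q i ≠ p) → ∀ (e : Fin m → ℤ), e ≠ 0 → 1 ≤ padicValRat p (∏ i, (q i : ℚ) ^ e i - 1) → ∃ (α : Fin m → ℚ) (e' : Fin m → ℤ), (∀ j, α j ≠ 0 ∧ 1 ≤ padicValRat p (α j - 1)) ∧ (∀ μ : Fin m → ℤ, ∏ j, α j ^ μ j = 1 → μ = 0) ∧ (∀ T : Finset (Fin m), T.Nonempty → ¬ IsSquare (∏ j ∈ T, α j)) ∧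 e' ≠ 0 ∧ ∏ i, (q i : ℚ) ^ e i = ∏ j, α j ^ e' j ∧ (∏ j, Height.logHeight₁ (α j)) ≤ (m : ℝ) ^ m * Real.sqrt (m.factorial) * p * ∏ i, Real.log (q i) ∧ (∀ j, (|e' j| : ℝ) ≤ (m : ℝ) ^ (2 * m) * p * (∏ i, Real.log (q i)) * (Finset.univ.sup fun i => (e i).natAbs)) ∧ (∀ j, Real.log p ≤ 2 * Height.logHeight₁ (α j))) → ∀ (C : ℕ → ℝ) (r : ℕ → ℕ) (c₁ c₂ : ℝ), 1 ≤ c₁ → 0 ≤ c₂ → (∀ m, 0 ≤ C m ∧ C m ≤ c₁ ^ m * (m : ℝ) ^ (c₂ * m)) → (∀ (p : ℕ), p.Prime → p ≠ 2 → ∀ (m : ℕ) (α : Fin m → ℚ) (b : Fin m → ℤ) (V : Fin m → ℝ) (Vmax W : ℝ), (∀ j, α j ≠ 0 ∧ 1 ≤ padicValRat p (α j - 1)) → (∀ μ : Fin m → ℤ, ∏ j, α j ^ μ j = 1 → μ = 0) → (∀ T : Finset (Fin m), T.Nonempty → ¬ IsSquare (∏ j ∈ T, α j)) → (∀ j, Height.logHeight₁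 (α j) ≤ V j) → (∀ j, Real.log p ≤ V j) → (∀ j, V j ≤ Vmax) → b ≠ 0 → (∀ j, Real.log (max 3 (|b j| : ℝ)) ≤ W) → (padicValRat p (∏ j, α j ^ b j - 1) : ℝ) * Real.log p ≤ C m * (∏ j, V j) * (W + Real.log (2 * Vmax)) * Real.log (2 * Vmax) / Real.log p ^ r m) → ∃ (K L κ : ℝ), 0 ≤ K ∧ 1 ≤ L ∧ 0 ≤ κ ∧ κ ≤ c₂ + 3 / 2 ∧ ∀ p, p.Prime → p ≠ 2 → (∀ (n : ℕ) (q : Fin n → ℕ) (e : Fin n → ℤ), (∀ i, (q i).Prime) → Function.Injective q → (∀ i, q i ≠ p) → e ≠ 0 → ∏ i, ((q i : ℚ)) ^ e i ≠ 1 → (padicValRat p (∏ i, ((q i : ℚ)) ^ e i - 1) : ℝ) ≤ K * L ^ n * (n : ℝ) ^ (κ * n) * (p : ℝ) ^ (2:ℝ) * (∏ i, Real.log (q i)) * Real.log (max 3 ((Finset.univ.sup fun i => (e i).natAbs : ℕ) : ℝ)) ^ (2:ℕ) * Real.log (max 3 (∏ i, ((q i : ℕ) : ℝ))) ^ (2:ℕ))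 := by
  intro hM C r c₁ c₂ hc₁ hc₂ hC hA
  refine ⟨4704, 32 * c₁, c₂ + 3 / 2, by norm_num, by linarith, by linarith, le_rfl, ?_⟩
  intro p hp hp2 n q e hq hinj hqp he hne1
  exact primePadicBoundAt_odd_of_principal_general
    (A := fun m => (m : ℝ) ^ m * Real.sqrt (m.factorial)) (c₄ := 3 / 2) (by norm_num)
    pow_mul_sqrt_factorial_le_rpow hM hc₁ hC hA hp hp2 n q e hq hinj hqp he hne1

end Literature.NumberTheory.Transcendental.StewartYu

end Part8

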